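import Literature.NumberTheory.ComplexMultiplication.SerreGroupOrbitToriHomomorphism
import Literature.NumberTheory.ComplexMultiplication.WeilTorusToSerreGroupLimit
import Literature.NumberTheory.ComplexMultiplication.CMTypeOrbitReduction
import HarnessLib

/-!
# Milne 1999 §6 LEMMA 6.2 IN THE LIMIT, on characters: the square of fundamental groups `T ← S` over `T ← L ← P`
# — `X^*(T) = X^*(∏_Ψ (T^Ψ, t^Ψ))`, `X^*(L) = X^*(∏_Π (L^Π, l^Π))` over ALL orbits, `γ`, `β`, `α′`, `α`, and «the diagram commutes»
# (J. S. Milne, *Lefschetz motives and the Tate conjecture*, Compositio Math. 117 (1999), §1 p. 48, Thm 2.6 p. 56, Thm 4.3 p. 61,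
# §5 pp. 64–65, §6 pp. 65–66)

Family `hodge`, lane `lit-hodgefound` (Layer A3; seat `lit-hodgefound-p27`, generation 21, row g21-#1); topic
`Literature/NumberTheory/ComplexMultiplication`, namespaces `Literature.NumberTheory.ComplexMultiplication.PairProduct` (§0, generic),
`….OrbitTorus` (one ext lemma) and `….CMNumbers` (§§1–7).  Definitions WITH BODIES (`PairProduct.drel`/`DAmalg`/`dinj`/`dliftOf`/`dmapOf`; `tFamT`,
`TChar = X^*(T)`, `tT = t`, `gammaT = X^*(γ)`, `WeilOnePlusOrbits = Γ\W_{1,+}(p^∞)`, `lBase`, `lClass`, `lFamL`, `LChar = X^*(L)`, `lL = l`,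
`betaL = X^*(β)`, `cmTypeGermLim = π`, `redIdx = (Ψ ↦ Π(Ψ))`, `redLim`, `alphaPrimeOrbit`, `alphaPrimeT = X^*(α′)`, `extendCMType`, the `Γ`-actions
`tRepT`, `lRepL`, and the points `tTorusPoints = T(R)`, `lTorusPoints = L(R)`, `tPointsT`, `lPointsL`, `gammaTPoints`, `betaLPoints`, `alphaPrimeTPoints`)
validated in-file by the theorems below; no named fact (D-0026, net debt 0).  Sequel of the seat's Milne-1999 series: g15-#1 `SerreGroupOrbitToriHomomorphism`
(`X^*(γ^Ψ) = gammaChar`, `indicatorI`, `sChar`, `iSup_range_gammaChar_eq_top`, `orbitBase`), g15-#3 `WeilNumberTorus` (`WeilLimit p = W(p^∞) = X^*(P)`,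
`weilLimOnePlus = W_{1,+}(p^∞)`, `weilOrbitChar = X^*(L^Π)`, `lWeil = l^Π`, `betaChar = X^*(β^Π)`, `weilTorusPoints = P(R)`), Q731 `CMTypeOrbitTorus`
(`OrbitTorus.CharModule`, `torusChar = X^*(T^Ψ)`, `tTorus = t^Ψ`), g16-#6 `CMTypeOrbitReduction` (`OrbitTorus.push`, `cmTypeGerm = π(Φ)`,
`exists_cmTypeGerm_eq`), g16-#4 `WeilTorusToOrbitToriInjective` (`toMul_alphaCharOfPrime_mem_weilLimOnePlus`, `closure_weilLimitInOnePlus_eq`), g20-#1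
`WeilTorusLevelsExhaustLimit` (`exists_level_mem_weilLimitIn'`, `weilLimitIn_le_of_algHom`) and g20-#3 `WeilTorusToSerreGroupLimit` / `SerreGroupLimitLevelCharacters`
(`alphaLim p 𝔴 = X^*(α)`, `alphaLim_rep`, `alphaLim_surjective`, `alphaLim_extendLevel`, `alphaLimPoints`; `resLevel`, `levelChar`, `extendLevel`).

THE PRINT.  [Milne1999] (held `paper:doi-10-1023-a-1000776613765`, printed page = PDF page + 44), verbatim.  §1 p. 48 L31–L35: «Let `(G_i, t_i)_{i∈I}`
be a family of pairs consisting of an algebraic group `G_i` and a homomorphism `t_i : G_i → 𝔾_m`. We define the product `∏_{i∈I}(G_i, t_i)` of the family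
to be the pair `(G, t)` consisting of the largest subgroup of `∏ G_i` on which the characters `(g_i)_{i∈I} ↦ t_{i₀}(g_{i₀})` agree and of the common
restriction of these characters to `G`. It is universal with respect to the maps `(G, t) → (G_i, t_i)`.»  THEOREM 2.6 (p. 56 L26–L31): «For any
CM-subfield `K` of `ℚ^{al}`, the fundamental group `(T^K, t^K)` of `LCM^K(ℂ)` is `∏_Ψ (T^Ψ, t^Ψ)`, where the product is over the set of `Γ`-orbits of
CM-types on `K`.» (for `K = ℚ^{cm}` the superscript is omitted, p. 55 L30.)  THEOREM 4.3 (p. 61 L14): «The fundamental group of `LMot(𝔽)` is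
`∏_{Π∈Γ\W_{1,+}(p^∞)} (L^Π, l^Π)`.»  §4 p. 62 L19–L31 («THE MAP `β^K : P^K → L^K`»): «… factors through `X^*(L^Π)` and, hence, defines a homomorphism
`β^Π : P^K → L^Π`. This map sends `p^K` to `l^Π` and, hence, the family `(β^Π)_{Π∈W_{1,+}(p^∞)}` defines a homomorphism `β^K : (P^K, p^K) → (L^K, l^K)`,
which is injective because it corresponds to a surjective map on the character groups. On passing to the inverse limit over all `K ⊂ ℚ^{cm}` finite and
Galois over `ℚ`, we obtain an injective homomorphism `β : (P, p) → (L, l)`.»  §5 p. 64 L69 – p. 65 L9 («THE REDUCTION FUNCTOR»): «Above, we defined a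
surjective homomorphism `f ↦ π(f) : X^*(S^K) → W^K(p^∞)` which sends CM-types on `K` to Weil integers of weight `−1`. Since the map is `Γ`-equivariant, to
each `Γ`-orbit `Ψ` of CM-types it attaches a `Γ`-orbit `Π(Ψ)` of Weil integers of weight `−1` and a surjective `Γ`-equivariant homomorphism `Ψ → Π(Ψ)`.
This last map induces a surjective homomorphism `Σ_{ψ∈Ψ} f(ψ)ψ ↦ Σ_{ψ∈Ψ} f(ψ)π(ψ) : X^*(T^Ψ) → X^*(L^Π)` sending `t^Ψ` to `l^Π` and, hence, an
injective homomorphism `α′^Ψ : (L^{Π(Ψ)}, l^{Π(Ψ)}) → (T^Ψ, t^Ψ)`. On combining these maps for all `Ψ`, we obtain a injective homomorphism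
`α′^K : (L^K, l^K) → (T^K, t^K)`.»  §6 p. 65 L31–L44: «Recall that we have defined affine group schemes of multiplicative type: `T : LCM(ℚ^{al})` …
`S : CM(ℚ^{al})` … `L : LMot(𝔽)` … `P : ?Mot(𝔽)?` … We have defined injective homomorphisms as in the left-hand square [`T ← S` (`γ`), `T ← L` (`α′`),
`S ← P` (`α`), `L ← P` (`β`)]»; p. 66 L9–L12, L33–L34: «LEMMA 6.2. The diagram [`T^K ← S^K` over `L^K ← P^K`] commutes. Proof. We check this on the
character groups. Let `Ψ` be a `Γ`-orbit of CM-types on `K`, and let `f ∈ ℤ^Ψ`. Then `f` represents an element of `X^*(T^K)`, and its image in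
`X^*(P^K) =_{df} W^K(p^∞)` under either map in the diagram is `∏_{ψ∈Ψ} π(ψ)^{f(ψ)}`. □  On passing to the limit over all `K ⊂ ℚ^{cm}`, we find that
the diagram referred to in Theorem 6.1 commutes.»

WHAT IS FORMALISED, AND HOW.  The diagram of p. 65 READ ON CHARACTER GROUPS, AT THE INFINITE LEVEL `K = ℚ^{cm}`: a homomorphism of groups of
multiplicative type over `ℚ` is, dually, a `Γ`-equivariant homomorphism of character modules, and «passing to the limit over all `K`» on the groups is, on
characters, working with the full character modules `X^*(S) = I` (g13), `X^*(P) = W(p^∞)` (g15) and — new here — `X^*(T)`, `X^*(L)`.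
* §0 PRODUCTS OF PAIRS OVER AN ARBITRARY INDEX SET.  For an infinite family the character group of `∏ (G_i, t_i)` is the amalgamated DIRECT sum
  `(⊕_i X^*(G_i))/⟨t_i − t_j⟩` (g17-#5's `PairProduct.Amalg` is the finite-index case on `Π i, M i`): `drel`, **`DAmalg`**, the coprojections **`dinj`**
  with `dinj_t_eq` (the common class `t`), the universal property **`dliftOf`** (`dliftOf_dinj`, `range_dliftOf`, `dliftOf_surjective_of_iSup_eq_top`),
  functoriality **`dmapOf`** (`dmapOf_dinj`), `hom_ext`, `induction_on`, `iSup_range_dinj`.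
* §1 **`TChar = X^*(T) = X^*(∏_Ψ (T^Ψ, t^Ψ))`** over the set `CMTypeOrbits = Γ\{CM-types on ℚ^{cm}}` (summands Q731 `torusChar ℤ (orbitBase ω)`, glued
  along `tFamT ω = t^Ψ`), **`tT = t`** (`dinj_tTorus`, `dinj_tChar`: every `[δ_Ψ(ψ + ιψ)]` is `t`), **`gammaT = X^*(γ) : X^*(T) → X^*(S)`** (summandwise
  g15-#1 `gammaChar`; `gammaT_dinj`, `gammaT_dinj_mk_single : [δ_ψ] ↦ 𝟙_ψ`), **`gammaT_tT : t ↦ s`**, and **`gammaT_surjective`** (the CM-types generate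
  `X^*(S)`, LNM III (1.7) via g15-#1 `iSup_range_gammaChar_eq_top`; i.e. REMARK 3.6 «`γ : S → T` is injective» for the full `S` and `T`).
* §2 **`WeilOnePlusOrbits p = Γ\W_{1,+}(p^∞)`** (orbit classes of `WeilLimit p` inside g15-#3 `weilLimOnePlus`), `lBase`, `lClass` (`orbit_lBase_lClass`,
  `lClass_lBase`, `lClass_eq_lClass_iff`, `lClass_smul`), **`LChar p = X^*(L) = X^*(∏_Π (L^Π, l^Π))`** (summands `weilOrbitChar ℤ (lBase c)` glued along
  `lFamL c = l^Π`), **`lL = l`** (`dinj_lWeil`, `dinj_tChar_weil`), **`betaL = X^*(β)`** (summandwise `betaChar`; `betaL_dinj_mk_single : [δ_π] ↦ [π]`),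
  **`betaL_lL : l ↦ [p]`**.
* §3 **`cmTypeGermLim p 𝔴 ψ = π(ψ) := α(𝟙_ψ)`** at §6's fixed prime `𝔴` of `ℚ^{cm}` over `p` (`cmTypeGermLim_smul`: `Γ`-equivariant;
  **`cmTypeGermLim_mem_weilLimOnePlus`**: «sends CM-types to Weil integers of weight `−1`», via a finite Galois CM level and g16-#4), **`redIdx = (Ψ ↦ Π(Ψ))`**
  on orbit classes, **`redLim : Ψ → Π(Ψ)`** («a surjective `Γ`-equivariant homomorphism»: `redLim_smul`, `redLim_surjective`), **`alphaPrimeOrbit :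
  X^*(T^Ψ) → X^*(L^{Π(Ψ)})`** (g16-#6 `OrbitTorus.push`; `alphaPrimeOrbit_mk_single`, **`alphaPrimeOrbit_tTorus : t^Ψ ↦ l^{Π(Ψ)}`**, `_rep`, `_surjective`),
  and **`alphaPrimeT = X^*(α′) : X^*(T) → X^*(L)`** («On combining these maps for all `Ψ`»; `alphaPrimeT_dinj`, `alphaPrimeT_dinj_mk_single : [δ_ψ] ↦ [δ_{π(ψ)}]`,
  **`alphaPrimeT_tT : t ↦ l`**).
* §4 **LEMMA 6.2 IN THE LIMIT**: **`betaL_comp_alphaPrimeT : X^*(β) ∘ X^*(α′) = X^*(α) ∘ X^*(γ)`** (checked on the generators `[δ_Ψ δ_ψ]`, where both sides are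
  `π(ψ)` — the printed proof), pointwise `betaL_alphaPrimeT`; `alphaLim_sChar : s ↦ [p]` (g20-#3), `betaL_alphaPrimeT_tT`.
* §5 SURJECTIVITY OF ALL FOUR ARROWS (= injectivity of `α`, `β`, `γ`, `α′` on the groups, and the standing hypothesis of §6's almost-cartesian squares):
  `exists_finiteGaloisLevel_mem_weilLimitIn` (every germ lies in `W^E(p^∞)` for a finite Galois CM `E ⊂ ℚ^{cm}`, g20-#1 moved inside `ℚ^{cm}`),
  **`extendCMType K Φ = {σ | σ|_K ∈ Φ}`** (the CM-type on `ℚ^{cm}` extending a CM type of a finite level; `indicatorI_extendCMType = extendLevel K λ_Φ`,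
  **`cmTypeGermLim_extendCMType : π(Φ^{ℚ^{cm}}) = cmTypeGerm p (𝔴 ∩ K) Φ`**), **`exists_cmTypeGermLim_eq`** (`π : {CM-types on ℚ^{cm}} → W_{1,+}(p^∞)` is
  onto: every `Π` is a `Π(Ψ)`; g16-#6 `exists_cmTypeGerm_eq` at a level), `redIdx_surjective`, **`alphaPrimeT_surjective`**, **`betaL_surjective`**
  (`W^E(p^∞)` is generated by `W^E_{1,+}(p^∞)`, g16-#4), `surjective_gammaT_alphaLim_betaL_alphaPrimeT`.
* §6 THE `Γ`-MODULE STRUCTURES **`tRepT`**, **`lRepL`** (summandwise `torusRep` / `weilOrbitRep`, through `dmapOf`; `tRepT_tT`, `lRepL_lL`: `t`, `l` are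
  `Γ`-fixed) and the equivariance **`gammaT_rep`**, **`betaL_rep`**, **`alphaPrimeT_rep`** (with g20-#3 `alphaLim_rep`: the four arrows are homomorphisms
  of groups over `ℚ`).
* §7 ON `R`-POINTS for every commutative `ℚ`-algebra `R` (Q768 `torusPoints`): **`tTorusPoints R = T(R)`**, **`lTorusPoints p R = L(R)`**, `tPointsT`,
  `lPointsL` (`galUnits_*`: rational over `ℚ`), **`gammaTPoints : S(R) → T(R)`**, **`betaLPoints : P(R) → L(R)`**, **`alphaPrimeTPoints : L(R) → T(R)`**
  (maps of pairs: `tPointsT_gammaTPoints = sPoints`, `lPointsL_betaLPoints = germChar [p]`, `tPointsT_alphaPrimeTPoints = lPointsL`), and **LEMMA 6.2 ON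
  POINTS: `gammaTPoints_alphaLimPoints : γ(R) ∘ α(R) = α′(R) ∘ β(R) : P(R) → T(R)`** (`gammaTPoints_comp_alphaLimPoints`).

SCOPE (docstring, not claims).  (1) `T`, `S`, `L`, `P` enter ONLY through their character modules and `R`-points; the identifications of `T`, `S`, `L`
with fundamental groups of the Tannakian categories `LCM(ℚ^{al})`, `CM(ℚ^{al})`, `LMot(𝔽)` (Thm 2.6, Thm 4.3 — resting on Honda–Tate, Prop. 4.1 —,
Thm 5.4 «the homomorphism … defined by the reduction functor is `α′`», and «`α`, `β` correspond to the natural functors», conjectural in print) are NOT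
formalised; Theorems 2.6 / 4.3 are quoted for the SHAPES `∏_Ψ (T^Ψ, t^Ψ)`, `∏_Π (L^Π, l^Π)` only.  (2) THEOREM 6.1 («identifies `P` with `L ∩ S`»,
i.e. the square is almost cartesian / `X^*(T) → X^*(L) ⊕ X^*(S) → X^*(P) → 0` exact) is NOT here — Layer B (B5-09); at a finite level `K` it is g18-#7
`exact_pairProductK_of_split`.  (3) `ℤ`-MODULE STRUCTURES: the quotient carriers carry Mathlib's two (propositionally equal, definitionally heavy)
`ℤ`-module structures (`Submodule.Quotient.module` from the generic-`R` constructions, `AddCommGroup.toIntModule` from instance search at `ℤ`); maps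
between amalgamated sums are therefore built with `dmapOf` (`Submodule.mapQ`) rather than `dliftOf`, and several proofs are in term mode / `calc` on
purpose (as in g15-#1).  (4) Index sets: all `DirectSum` constructions take `[DecidableEq]` of the orbit spaces as section hypotheses (any instances).
(5) Nothing in this file is a case of the Hodge conjecture.

## References

* [Milne1999] J. S. Milne, *Lefschetz motives and the Tate conjecture*, Compositio Math. 117 (1999) 45–76 — §1 p. 48 L31–L35 (products of pairs);
  §2 p. 55 L38–L48, Thm 2.6 p. 56 L26–L31; §3 p. 59 L3–L8, Remark 3.6; §4 p. 60 L8–L27, Thm 4.3 p. 61 L14, p. 62 L19–L31 (the map `β`); §5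
  p. 63 L6–L9 (`g ↦ π(g)`), Remark 5.2, p. 64 L69 – p. 65 L9 («The reduction functor», `Ψ → Π(Ψ)`, `α′`); §6 p. 65 L29–L44 (the four groups and the
  diagram), p. 66 L5–L12 and L33–L34 (Theorem 6.1, Lemma 6.2, «On passing to the limit») (held `paper:doi-10-1023-a-1000776613765` p0004, p0011,
  p0012, p0015, p0016–p0018, p0019–p0021, p0021–p0022).
* [MilneShih1982Taniyama] J. S. Milne, K.-y. Shih, *Langlands's construction of the Taniyama group*, LNM 900 (1982), art. III §1 (1.3), (1.7)
  (pp. 231, 233) — `X^*(S^K) ⊂ X^*(S)`, the CM-types generate `X^*(S)`.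
* [MilneCM2006] J. S. Milne, *Complex Multiplication* (course notes), Ch. I §1 p. 19 (CM-types on `ℚ^{cm}`), §4 pp. 40–42 (`I = lim→ I(K)`).
* [Milne2017] J. S. Milne, *Algebraic Groups*, CUP 2017 — Ch. 12 Thm 12.9, Rem. 12.26 (points of groups of multiplicative type; Q768
  `CharacterModuleTorusPoints`).

Provenance: lane `lit-hodgefound`, seat `lit-hodgefound-p27` gen 21 (agent `literature-prover-lit-hodgefound-p27-g21-0`), row g21-#1 (lane INBOX claim
2026-08-24, l.10261).
-/

set_option autoImplicit false

noncomputable section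

open scoped NumberField DirectSum Pointwise IntermediateField TensorProduct

namespace Literature.NumberTheory.ComplexMultiplication

/-! ### §0 Products of pairs over an ARBITRARY index set, on character modules: the amalgamated DIRECT sum `(⊕_i M_i)/⟨t_i − t_j⟩` -/

namespace PairProduct

variable (R : Type*) [CommRing R] {I : Type*} {M : I → Type*} [∀ i, AddCommGroup (M i)] [∀ i, Module R (M i)] [DecidableEq I]
variable (t : ∀ i, M i)

/-- **The relations of the product of pairs `∏_{i∈I} (G_i, t_i)` on character modules, for an arbitrary index set `I`**: the
submodule of the DIRECT SUM `⊕_i X^*(G_i)` spanned by the `δ_i t_i − δ_j t_j` (the character group of an infinite product of groups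
of multiplicative type is the direct sum of the character groups; «the largest subgroup of `∏ G_i` on which the characters
`(g_i) ↦ t_{i₀}(g_{i₀})` agree» is cut out by these differences).  g17-#5's `PairProduct.rel` is the same object on `Π i, M i`
for a finite `I`. [cite: Milne1999, §1 p. 48 L31–L35] -/
def drel : Submodule R (⨁ i, M i) :=
  Submodule.span R {x | ∃ i j : I, x = DirectSum.lof R I M i (t i) - DirectSum.lof R I M j (t j)}

/-- `δ_i t_i − δ_j t_j` is a relation. [cite: Milne1999, §1 p. 48 L31–L35] -/
theorem lof_sub_lof_mem (i j : I) : DirectSum.lof R I M i (t i) - DirectSum.lof R I M j (t j) ∈ drel R t :=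
  Submodule.subset_span ⟨i, j, rfl⟩

/-- **`X^*(∏_{i∈I} (G_i, t_i)) = (⊕_i X^*(G_i))/⟨t_i − t_j⟩`** for an arbitrary index set `I` (the amalgamated direct sum of the
`M_i` along the `t_i`). [cite: Milne1999, §1 p. 48 L31–L35] -/
abbrev DAmalg : Type _ := (⨁ i, M i) ⧸ drel R t

/-- **`X^*(G_i) → X^*(∏_j (G_j, t_j))`**, the `i`-th coprojection (dual to the projection `∏_j G_j ⊃ G → G_i`).
[cite: Milne1999, §1 p. 48 L31–L35 («universal with respect to the maps `(G, t) → (G_i, t_i)`»)] -/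
def dinj (i : I) : M i →ₗ[R] DAmalg R t := (drel R t).mkQ ∘ₗ DirectSum.lof R I M i

/-- [cite: Milne1999, §1 p. 48 L31–L35] -/
theorem dinj_apply (i : I) (x : M i) : dinj R t i x = Submodule.Quotient.mk (DirectSum.lof R I M i x) := rfl

/-- **The common class `t`**: `[δ_i t_i] = [δ_j t_j]` («the common restriction of these characters to `G`»).
[cite: Milne1999, §1 p. 48 L31–L35] -/
theorem dinj_t_eq (i j : I) : dinj R t i (t i) = dinj R t j (t j) :=
  (Submodule.Quotient.eq _).mpr (lof_sub_lof_mem R t i j)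

/-- **The universal property**: a family of linear maps `F_i : M_i → N` taking one and the same value on all the `t_i` factors
through the amalgamated direct sum. [cite: Milne1999, §1 p. 48 L31–L35 («It is universal …»)] -/
def dliftOf {N : Type*} [AddCommGroup N] [Module R N] (F : ∀ i, M i →ₗ[R] N) (hF : ∀ i j : I, F i (t i) = F j (t j)) :
    DAmalg R t →ₗ[R] N :=
  (drel R t).liftQ (DirectSum.toModule R I N F) (by
    rw [drel, Submodule.span_le]
    rintro x ⟨i, j, rfl⟩
    rw [SetLike.mem_coe, LinearMap.mem_ker, map_sub, DirectSum.toModule_lof, DirectSum.toModule_lof, hF i j, sub_self])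

/-- [cite: Milne1999, §1 p. 48 L31–L35] -/
@[simp] theorem dliftOf_mk {N : Type*} [AddCommGroup N] [Module R N] (F : ∀ i, M i →ₗ[R] N)
    (hF : ∀ i j : I, F i (t i) = F j (t j)) (x : ⨁ i, M i) :
    dliftOf R t F hF (Submodule.Quotient.mk x) = DirectSum.toModule R I N F x := rfl

/-- **`(dliftOf F) ∘ dinj_i = F_i`.** [cite: Milne1999, §1 p. 48 L31–L35] -/
@[simp] theorem dliftOf_dinj {N : Type*} [AddCommGroup N] [Module R N] (F : ∀ i, M i →ₗ[R] N)
    (hF : ∀ i j : I, F i (t i) = F j (t j)) (i : I) (x : M i) : dliftOf R t F hF (dinj R t i x) = F i x := by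
  rw [dinj_apply, dliftOf_mk, DirectSum.toModule_lof]

/-- Two linear maps out of the amalgamated direct sum agree as soon as they agree on every `dinj_i`. [cite: Milne1999, §1 p. 48 L31–L35] -/
theorem hom_ext {N : Type*} [AddCommGroup N] [Module R N] {f g : DAmalg R t →ₗ[R] N}
    (h : ∀ i, f ∘ₗ dinj R t i = g ∘ₗ dinj R t i) : f = g :=
  Submodule.linearMap_qext _ (DirectSum.linearMap_ext R fun i => h i)

/-- Every element of the amalgamated direct sum is a finite sum of values of the `dinj_i` (induction principle).
[cite: Milne1999, §1 p. 48 L31–L35] -/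
theorem induction_on {motive : DAmalg R t → Prop} (x : DAmalg R t) (zero : motive 0)
    (dinj : ∀ (i : I) (y : M i), motive (dinj R t i y)) (add : ∀ x y, motive x → motive y → motive (x + y)) : motive x := by
  induction x using Submodule.Quotient.induction_on with | H z => ?_
  induction z using DirectSum.induction_on with
  | zero => rw [Submodule.Quotient.mk_zero]; exact zero
  | of i y => exact dinj i y
  | add z w hz hw => rw [Submodule.Quotient.mk_add]; exact add _ _ hz hw

/-- The range of `dliftOf F` is the span of the ranges of the `F_i`. [cite: Milne1999, §1 p. 48 L31–L35] -/
theorem range_dliftOf {N : Type*} [AddCommGroup N] [Module R N] (F : ∀ i, M i →ₗ[R] N)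
    (hF : ∀ i j : I, F i (t i) = F j (t j)) : LinearMap.range (dliftOf R t F hF) = ⨆ i, LinearMap.range (F i) := by
  refine le_antisymm ?_ (iSup_le fun i => ?_)
  · rintro _ ⟨x, rfl⟩
    induction x using induction_on R t with
    | zero => rw [map_zero]; exact Submodule.zero_mem _
    | dinj i y => rw [dliftOf_dinj]; exact Submodule.mem_iSup_of_mem i ⟨y, rfl⟩
    | add x y hx hy => rw [map_add]; exact Submodule.add_mem _ hx hy
  · rintro _ ⟨y, rfl⟩
    exact ⟨dinj R t i y, dliftOf_dinj R t F hF i y⟩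

/-- `dliftOf F` is onto as soon as the ranges of the `F_i` span `N`. [cite: Milne1999, §1 p. 48 L31–L35] -/
theorem dliftOf_surjective_of_iSup_eq_top {N : Type*} [AddCommGroup N] [Module R N] (F : ∀ i, M i →ₗ[R] N)
    (hF : ∀ i j : I, F i (t i) = F j (t j)) (h : ⨆ i, LinearMap.range (F i) = ⊤) : Function.Surjective (dliftOf R t F hF) :=
  LinearMap.range_eq_top.mp ((range_dliftOf R t F hF).trans h)

/-- The `dinj_i` jointly generate the amalgamated direct sum. [cite: Milne1999, §1 p. 48 L31–L35] -/
theorem iSup_range_dinj : ⨆ i, LinearMap.range (dinj R t i) = ⊤ := by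
  refine Submodule.eq_top_iff'.mpr fun x => ?_
  induction x using induction_on R t with
  | zero => exact Submodule.zero_mem _
  | dinj i y => exact Submodule.mem_iSup_of_mem i ⟨y, rfl⟩
  | add x y hx hy => exact Submodule.add_mem _ hx hy

variable {I' : Type*} {M' : I' → Type*} [∀ j, AddCommGroup (M' j)] [∀ j, Module R (M' j)] [DecidableEq I'] (t' : ∀ j, M' j)

/-- **Functoriality**: a family of linear maps `F_i : M_i → ⊕_j M′_j` carrying the relations of `t` into those of `t′` (e.g. one sending `t_i` to
`δ_{σ(i)} t′_{σ(i)}`) induces a map of amalgamated direct sums — the shape of `X^*(α′) : X^*(T) → X^*(L)`. [cite: Milne1999, §1 p. 48 L31–L35; §5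
p. 65 L5–L9] -/
def dmapOf (F : ∀ i, M i →ₗ[R] ⨁ j, M' j)
    (hF : ∀ i j : I, F i (t i) - F j (t j) ∈ drel R t') : DAmalg R t →ₗ[R] DAmalg R t' :=
  (drel R t).mapQ (drel R t') (DirectSum.toModule R I _ F) (by
    rw [drel, Submodule.span_le]
    rintro x ⟨i, j, rfl⟩
    rw [SetLike.mem_coe, Submodule.mem_comap, map_sub, DirectSum.toModule_lof, DirectSum.toModule_lof]
    exact hF i j)

/-- [cite: Milne1999, §1 p. 48 L31–L35] -/
@[simp] theorem dmapOf_mk (F : ∀ i, M i →ₗ[R] ⨁ j, M' j) (hF : ∀ i j : I, F i (t i) - F j (t j) ∈ drel R t') (x : ⨁ i, M i) :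
    dmapOf R t t' F hF (Submodule.Quotient.mk x) = Submodule.Quotient.mk (DirectSum.toModule R I _ F x) := rfl

/-- **`(dmapOf F) ∘ dinj_i = [F_i]`.** [cite: Milne1999, §1 p. 48 L31–L35] -/
theorem dmapOf_dinj (F : ∀ i, M i →ₗ[R] ⨁ j, M' j) (hF : ∀ i j : I, F i (t i) - F j (t j) ∈ drel R t') (i : I) (x : M i) :
    dmapOf R t t' F hF (dinj R t i x) = Submodule.Quotient.mk (F i x) := by
  rw [dinj_apply, dmapOf_mk, DirectSum.toModule_lof]

end PairProduct

namespace OrbitTorus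

/-- Two linear maps out of a character module `R[S]/{f = ιf, Σ f = 0}` agree as soon as they agree on the classes `[δ_s]`.
[cite: Milne1999, §2 p. 55 L38–L45] -/
theorem charModule_hom_ext (R : Type*) [CommRing R] {G : Type*} [Group G] {S : Type*} [MulAction G S] (ι : G)
    {N : Type*} [AddCommGroup N] [Module R N] {f g : CharModule R S ι →ₗ[R] N}
    (h : ∀ s : S, f (Submodule.Quotient.mk (Finsupp.single s 1)) = g (Submodule.Quotient.mk (Finsupp.single s 1))) : f = g :=
  Submodule.linearMap_qext _ (Finsupp.lhom_ext' fun s => LinearMap.ext_ring (h s))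

end OrbitTorus

namespace CMNumbers

open _root_.NumberField
open Literature.NumberTheory.NumberFields (cmNumbers cmNumbersConj cmNumbersConj_mul_self cmNumbersConj_mul_comm)
open PairProduct (DAmalg dinj dliftOf)

/-! ### §1 `X^*(T) = X^*(∏_Ψ (T^Ψ, t^Ψ))` over ALL `Γ`-orbits `Ψ` of CM-types on `ℚ^{cm}` (Thm 2.6 with `K = ℚ^{cm}`), `t`, and `γ : X^*(T) → X^*(S)` -/

section TSide

/-- The index set of `T = ∏_Ψ (T^Ψ, t^Ψ)`: **the set of `Γ`-orbits of CM-types on `ℚ^{cm}`** (g15-#1's `orbitBase ω` is a chosen base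
point of the orbit `ω`). [cite: Milne1999, §2 Thm 2.6 p. 56 L26–L31 («the product is over the set of Γ-orbits of CM-types on K»)] -/
abbrev CMTypeOrbits : Type := MulAction.orbitRel.Quotient (cmNumbers ≃ₐ[ℚ] cmNumbers) GalCMType

/-- The family `(t^Ψ)_Ψ` of canonical characters along which the `X^*(T^Ψ)` are amalgamated (Q731 `tTorus` at the base points).
[cite: Milne1999, §2 p. 55 L45–L48, Thm 2.6 p. 56] -/
def tFamT : ∀ ω : CMTypeOrbits, torusChar ℤ (orbitBase ω) := fun ω => tTorus ℤ (orbitBase ω)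

/-- [cite: Milne1999, §2 p. 55 L45–L48] -/
@[simp] theorem tFamT_apply (ω : CMTypeOrbits) : tFamT ω = tTorus ℤ (orbitBase ω) := rfl

/-- The transport of Q731's character modules along an equality of orbits `Γ·a = Γ·b` (Q731 `OrbitTorus.congr` along the identity
bijection; g18-#7 has the same plumbing as `charModuleOrbitCongr`). [cite: Milne1999, §2 p. 55 L45–L47 («independent of the choice of ψ ∈ Ψ»)] -/
def orbitCharCongr {α : Type*} [MulAction (cmNumbers ≃ₐ[ℚ] cmNumbers) α] {a b : α}
    (e : MulAction.orbit (cmNumbers ≃ₐ[ℚ] cmNumbers) a = MulAction.orbit (cmNumbers ≃ₐ[ℚ] cmNumbers) b) :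
    OrbitTorus.CharModule ℤ (MulAction.orbit (cmNumbers ≃ₐ[ℚ] cmNumbers) a) cmNumbersConj ≃ₗ[ℤ]
      OrbitTorus.CharModule ℤ (MulAction.orbit (cmNumbers ≃ₐ[ℚ] cmNumbers) b) cmNumbersConj :=
  OrbitTorus.congr ℤ cmNumbersConj (Equiv.setCongr e) fun _ _ => Subtype.ext rfl

/-- [cite: Milne1999, §2 p. 55 L45–L47] -/
theorem orbitCharCongr_mk {α : Type*} [MulAction (cmNumbers ≃ₐ[ℚ] cmNumbers) α] {a b : α}
    (e : MulAction.orbit (cmNumbers ≃ₐ[ℚ] cmNumbers) a = MulAction.orbit (cmNumbers ≃ₐ[ℚ] cmNumbers) b)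
    (f : MulAction.orbit (cmNumbers ≃ₐ[ℚ] cmNumbers) a →₀ ℤ) :
    orbitCharCongr e (Submodule.Quotient.mk f) = Submodule.Quotient.mk (OrbitTorus.transfer ℤ (Equiv.setCongr e) f) := rfl

/-- [cite: Milne1999, §2 p. 55 L45–L47] -/
theorem orbitCharCongr_mk_single {α : Type*} [MulAction (cmNumbers ≃ₐ[ℚ] cmNumbers) α] {a b : α}
    (e : MulAction.orbit (cmNumbers ≃ₐ[ℚ] cmNumbers) a = MulAction.orbit (cmNumbers ≃ₐ[ℚ] cmNumbers) b)
    (x : MulAction.orbit (cmNumbers ≃ₐ[ℚ] cmNumbers) a) (r : ℤ) :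
    orbitCharCongr e (Submodule.Quotient.mk (Finsupp.single x r)) = Submodule.Quotient.mk (Finsupp.single ⟨x.1, e ▸ x.2⟩ r) := by
  rw [orbitCharCongr_mk, OrbitTorus.transfer_single]
  rfl

/-- `X^*(γ^Ψ)[r δ_ψ] = r 𝟙_ψ`. [cite: Milne1999, §3 p. 59 L3–L5] -/
theorem gammaChar_mk_single_smul (Ψ₀ : GalCMType) (ψ : MulAction.orbit (cmNumbers ≃ₐ[ℚ] cmNumbers) Ψ₀) (r : ℤ) :
    gammaChar Ψ₀ (Submodule.Quotient.mk (Finsupp.single ψ r)) = r • indicatorI (ψ : GalCMType) := by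
  rw [gammaChar_mk, Finsupp.linearCombination_single]

/-- `X^*(γ^Ψ)` computed at two base points of the same orbit agree along the transport. [cite: Milne1999, §3 p. 59 L3–L8] -/
theorem gammaChar_orbitCharCongr {Ψ₀ Ψ₁ : GalCMType}
    (e : MulAction.orbit (cmNumbers ≃ₐ[ℚ] cmNumbers) Ψ₀ = MulAction.orbit (cmNumbers ≃ₐ[ℚ] cmNumbers) Ψ₁) (x : torusChar ℤ Ψ₀) :
    gammaChar Ψ₁ (orbitCharCongr e x) = gammaChar Ψ₀ x := by
  induction x using Submodule.Quotient.induction_on with | H f => ?_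
  induction f using Finsupp.induction_linear with
  | zero => simp only [Submodule.Quotient.mk_zero, map_zero]
  | add f₁ f₂ h₁ h₂ => simp only [Submodule.Quotient.mk_add, map_add, h₁, h₂]
  | single ψ r => rw [orbitCharCongr_mk_single, gammaChar_mk_single_smul, gammaChar_mk_single_smul]

/-- The orbit of a CM-type is the orbit of the base point of its class. [cite: Milne1999, §2 p. 55 (Prop. 2.2)] -/
theorem orbit_eq_orbit_orbitBase (Ψ₀ : GalCMType) :
    MulAction.orbit (cmNumbers ≃ₐ[ℚ] cmNumbers) Ψ₀ =
      MulAction.orbit (cmNumbers ≃ₐ[ℚ] cmNumbers) (orbitBase (Quotient.mk'' Ψ₀ : CMTypeOrbits)) :=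
  MulAction.orbit_eq_iff.mpr (mem_orbit_orbitBase Ψ₀)

variable [DecidableEq CMTypeOrbits]

/-- **`X^*(T) = X^*(∏_Ψ (T^Ψ, t^Ψ))`, THE CHARACTER MODULE OF THE FUNDAMENTAL GROUP `T` OF `LCM(ℚ^{al})`** read through THEOREM 2.6 at
`K = ℚ^{cm}`: the amalgamated direct sum of the `X^*(T^Ψ)` (Q731 `torusChar ℤ`) over all `Γ`-orbits `Ψ` of CM-types on `ℚ^{cm}`, along the `t^Ψ`.
The identification of `T` with a fundamental group of motives is NOT formalised (Theorem 2.6 is quoted for the SHAPE `∏_Ψ (T^Ψ, t^Ψ)` only).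
[cite: Milne1999, §2 Thm 2.6 p. 56 L26–L31; §1 p. 48 L31–L35; §6 p. 65 L14–L16 («T : LCM(ℚ^{al})»)] -/
abbrev TChar : Type := DAmalg ℤ tFamT

/-- A base orbit (there are CM-types on `ℚ^{cm}`, `nonempty_galCMType`). [cite: Milne1999, §2 p. 55 (Prop. 2.2)] -/
def baseOrbitT : CMTypeOrbits := Quotient.mk'' (Classical.choice nonempty_galCMType)

/-- **`t ∈ X^*(T)`**, the common class of the `t^Ψ`. [cite: Milne1999, §2 Thm 2.6 p. 56; §1 p. 48 L31–L35] -/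
def tT : TChar := dinj ℤ tFamT baseOrbitT (tFamT baseOrbitT)

/-- Every `[δ_Ψ t^Ψ]` is `t`. [cite: Milne1999, §1 p. 48 L31–L35 («the common restriction»)] -/
theorem dinj_tTorus (ω : CMTypeOrbits) : dinj ℤ tFamT ω (tTorus ℤ (orbitBase ω)) = tT :=
  PairProduct.dinj_t_eq ℤ tFamT ω baseOrbitT

/-- Every `[δ_Ψ (ψ + ιψ)]`, `ψ ∈ Ψ`, is `t`. [cite: Milne1999, §2 p. 55 L45–L47 («independent of the choice of ψ ∈ Ψ»)] -/
theorem dinj_tChar (ω : CMTypeOrbits) (ψ : MulAction.orbit (cmNumbers ≃ₐ[ℚ] cmNumbers) (orbitBase ω)) :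
    dinj ℤ tFamT ω (OrbitTorus.tChar ℤ cmNumbersConj ψ) = tT := by
  rw [← tTorus_eq_tChar, dinj_tTorus]

/-- **`γ = X^*(γ) : X^*(T) → X^*(S) = I`**, the map on characters of `γ = (γ^Ψ)_Ψ : (S, s) → ∏_Ψ (T^Ψ, t^Ψ) = (T, t)`: on the summand
`X^*(T^Ψ)` it is g15-#1's `X^*(γ^Ψ) = gammaChar`, `[f] ↦ Σ_ψ f(ψ)𝟙_ψ` — well defined on the amalgamated sum because every `t^Ψ ↦ s`.
[cite: Milne1999, §3 p. 59 L3–L8 (Prop. 3.5), §6 p. 65 (the diagram, arrow `γ`)] -/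
def gammaT : TChar →ₗ[ℤ] infinityTypesCM :=
  dliftOf ℤ tFamT (fun ω => gammaChar (orbitBase ω)) fun ω ω' => by rw [tFamT_apply, tFamT_apply, gammaChar_tTorus, gammaChar_tTorus]

/-- `γ` on the summand `X^*(T^Ψ)` is `X^*(γ^Ψ)`. [cite: Milne1999, §3 p. 59 L3–L8] -/
@[simp] theorem gammaT_dinj (ω : CMTypeOrbits) (x : torusChar ℤ (orbitBase ω)) : gammaT (dinj ℤ tFamT ω x) = gammaChar (orbitBase ω) x :=
  PairProduct.dliftOf_dinj ℤ tFamT _ _ ω x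

/-- **`γ[δ_ψ] = 𝟙_ψ`** («`ψ ↦ ψ`», a CM-type read as a character of `S`). [cite: Milne1999, §3 p. 59 L3–L5] -/
theorem gammaT_dinj_mk_single (ω : CMTypeOrbits) (ψ : MulAction.orbit (cmNumbers ≃ₐ[ℚ] cmNumbers) (orbitBase ω)) :
    gammaT (dinj ℤ tFamT ω (Submodule.Quotient.mk (Finsupp.single ψ 1))) = indicatorI (ψ : GalCMType) := by
  rw [gammaT_dinj, gammaChar_mk_single]

/-- **`γ : (T, t) ← (S, s)` is a map of pairs: `X^*(γ)(t) = s`.** [cite: Milne1999, §3 p. 59 L5–L8 («its composite with t^Ψ is s»)] -/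
theorem gammaT_tT : gammaT tT = sChar := by
  rw [tT, gammaT_dinj, tFamT_apply, gammaChar_tTorus]

/-- **`γ = X^*(γ) : X^*(T) → X^*(S)` IS SURJECTIVE** — the CM-types generate `X^*(S) = I` (g15-#1 `iSup_range_gammaChar_eq_top`, LNM III (1.7)):
on characters, REMARK 3.6 «`γ : S → T` is injective» holds for the full Serre group and `T = ∏_Ψ T^Ψ` over all orbits.
[cite: Milne1999, §3 p. 59 Remark 3.6] [cite: MilneShih1982Taniyama, III §1 (1.7) (p. 233)] -/
theorem gammaT_surjective : Function.Surjective gammaT := by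
  refine PairProduct.dliftOf_surjective_of_iSup_eq_top ℤ tFamT _ _ (top_unique ?_)
  rw [← iSup_range_gammaChar_eq_top]
  refine iSup_le fun Ψ₀ => ?_
  rintro _ ⟨x, rfl⟩
  refine Submodule.mem_iSup_of_mem (Quotient.mk'' Ψ₀) ⟨orbitCharCongr (orbit_eq_orbit_orbitBase Ψ₀) x, ?_⟩
  exact gammaChar_orbitCharCongr _ x

/-- The range of `γ` is all of `X^*(S)`. [cite: Milne1999, §3 p. 59 Remark 3.6] -/
theorem range_gammaT : LinearMap.range gammaT = ⊤ := LinearMap.range_eq_top.mpr gammaT_surjective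

end TSide

/-! ### §2 `X^*(L) = X^*(∏_{Π ∈ Γ\W_{1,+}(p^∞)} (L^Π, l^Π))` (Thm 4.3), `l`, and `β : X^*(L) → X^*(P) = W(p^∞)` -/

section LSide

variable (p : ℕ) [hp : Fact p.Prime]

/-- The index set of `L = ∏_Π (L^Π, l^Π)`: **the set `Γ\W_{1,+}(p^∞)` of `Γ`-orbits of germs of Weil integers of weight `−1`** (the orbit classes
of g15-#3's `WeilLimit p` contained in `weilLimOnePlus p`; `W_{1,+}(p^∞)` is `Γ`-stable, `orbit_subset_weilLimOnePlus`).
[cite: Milne1999, §4 Thm 4.3 p. 61 L14 («Π ∈ Γ\W_{1,+}(p^∞)»), p. 60 L11–L12, L22] -/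
abbrev WeilOnePlusOrbits : Type :=
  {c : MulAction.orbitRel.Quotient (cmNumbers ≃ₐ[ℚ] cmNumbers) (WeilLimit p) // c.orbit ⊆ weilLimOnePlus p}

variable {p}

/-- A base point `ϖ_Π ∈ Π` of the orbit `Π ∈ Γ\W_{1,+}(p^∞)` (a choice of representative; `l^Π` does not depend on it, `lWeil_eq_tChar`).
[cite: Milne1999, §4 p. 60 L25–L26 («independent of the choice of π ∈ Π»)] -/
def lBase (c : WeilOnePlusOrbits p) : WeilLimit p := c.1.out

/-- `ϖ_Π ∈ Π`. [cite: Milne1999, §4 p. 60 L22–L26] -/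
theorem lBase_mem_orbit (c : WeilOnePlusOrbits p) : lBase c ∈ c.1.orbit :=
  MulAction.orbitRel.Quotient.mem_orbit.mpr c.1.out_eq'

/-- `Π = Γ·ϖ_Π`. [cite: Milne1999, §4 p. 60 L22–L26] -/
theorem orbit_lBase (c : WeilOnePlusOrbits p) : MulAction.orbit (cmNumbers ≃ₐ[ℚ] cmNumbers) (lBase c) = c.1.orbit := by
  rw [MulAction.orbitRel.Quotient.orbit_eq_orbit_out _ Quotient.out_eq']
  rfl

/-- `ϖ_Π ∈ W_{1,+}(p^∞)`. [cite: Milne1999, §4 p. 60 L11–L12, L22] -/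
theorem lBase_mem (c : WeilOnePlusOrbits p) : lBase c ∈ weilLimOnePlus p := c.2 (lBase_mem_orbit c)

/-- `ϖ_Π` has weight `−1` (`weilLimExp = 1` in g15-#3's convention). [cite: Milne1999, §4 p. 60 L11–L12] -/
theorem weilLimExp_lBase (c : WeilOnePlusOrbits p) : weilLimExp (lBase c) = 1 := weilLimExp_eq_one_of_mem (lBase_mem c)

variable (p) in
/-- **The class `Π = Γ·x ∈ Γ\W_{1,+}(p^∞)` of a germ `x ∈ W_{1,+}(p^∞)`.** [cite: Milne1999, §4 p. 60 L22 («a Γ-orbit Π in W_{1,+}(p^∞)»)] -/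
def lClass (x : WeilLimit p) (hx : x ∈ weilLimOnePlus p) : WeilOnePlusOrbits p :=
  ⟨Quotient.mk'' x, by rw [MulAction.orbitRel.Quotient.orbit_mk]; exact orbit_subset_weilLimOnePlus hx⟩

/-- [cite: Milne1999, §4 p. 60 L22] -/
theorem coe_lClass (x : WeilLimit p) (hx : x ∈ weilLimOnePlus p) :
    (lClass p x hx).1 = (Quotient.mk'' x : MulAction.orbitRel.Quotient (cmNumbers ≃ₐ[ℚ] cmNumbers) (WeilLimit p)) := rfl

/-- `Γ·ϖ_{[x]} = Γ·x`. [cite: Milne1999, §4 p. 60 L22–L26] -/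
theorem orbit_lBase_lClass (x : WeilLimit p) (hx : x ∈ weilLimOnePlus p) :
    MulAction.orbit (cmNumbers ≃ₐ[ℚ] cmNumbers) (lBase (lClass p x hx)) = MulAction.orbit (cmNumbers ≃ₐ[ℚ] cmNumbers) x := by
  rw [orbit_lBase, coe_lClass, MulAction.orbitRel.Quotient.orbit_mk]

/-- `x ∈ Γ·ϖ_{[x]}`. [cite: Milne1999, §4 p. 60 L22–L26] -/
theorem mem_orbit_lBase_lClass (x : WeilLimit p) (hx : x ∈ weilLimOnePlus p) :
    x ∈ MulAction.orbit (cmNumbers ≃ₐ[ℚ] cmNumbers) (lBase (lClass p x hx)) := by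
  rw [orbit_lBase_lClass]
  exact MulAction.mem_orbit_self x

/-- `[ϖ_Π] = Π`. [cite: Milne1999, §4 p. 60 L22–L26] -/
theorem lClass_lBase (c : WeilOnePlusOrbits p) : lClass p (lBase c) (lBase_mem c) = c :=
  Subtype.ext (MulAction.orbitRel.Quotient.mem_orbit.mp (lBase_mem_orbit c))

/-- Two germs have the same class iff they lie in one `Γ`-orbit. [cite: Milne1999, §4 p. 60 L22] -/
theorem lClass_eq_lClass_iff (x y : WeilLimit p) (hx : x ∈ weilLimOnePlus p) (hy : y ∈ weilLimOnePlus p) :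
    lClass p x hx = lClass p y hy ↔ x ∈ MulAction.orbit (cmNumbers ≃ₐ[ℚ] cmNumbers) y := by
  rw [← Subtype.coe_inj, coe_lClass, coe_lClass, Quotient.eq'']
  rfl

/-- `[σx] = [x]`. [cite: Milne1999, §4 p. 60 L22] -/
theorem lClass_smul (σ : cmNumbers ≃ₐ[ℚ] cmNumbers) (x : WeilLimit p) (hx : x ∈ weilLimOnePlus p) :
    lClass p (σ • x) (smul_mem_weilLimOnePlus σ hx) = lClass p x hx :=
  (lClass_eq_lClass_iff _ _ _ _).mpr (MulAction.mem_orbit x σ)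

/-- `Γ\W_{1,+}(p^∞)` is non-empty (g15-#3 `weilLimOnePlus_nonempty`). [cite: Milne1999, §4 p. 60 L11–L12] -/
instance nonempty_weilOnePlusOrbits : Nonempty (WeilOnePlusOrbits p) :=
  ⟨lClass p _ (weilLimOnePlus_nonempty (p := p)).some_mem⟩

/-- The family `(l^Π)_Π` of canonical characters along which the `X^*(L^Π)` are amalgamated (g15-#3 `lWeil` at the base points).
[cite: Milne1999, §4 p. 60 L25–L27, Thm 4.3 p. 61] -/
def lFamL : ∀ c : WeilOnePlusOrbits p, weilOrbitChar ℤ (lBase c) := fun c => lWeil ℤ (lBase c)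

/-- [cite: Milne1999, §4 p. 60 L25–L27] -/
@[simp] theorem lFamL_apply (c : WeilOnePlusOrbits p) : lFamL c = lWeil ℤ (lBase c) := rfl

variable [DecidableEq (MulAction.orbitRel.Quotient (cmNumbers ≃ₐ[ℚ] cmNumbers) (WeilLimit p))]

variable (p) in
/-- **`X^*(L) = X^*(∏_{Π ∈ Γ\W_{1,+}(p^∞)} (L^Π, l^Π))`, THE CHARACTER MODULE OF THE FUNDAMENTAL GROUP `L` OF `LMot(𝔽)`** read through THEOREM 4.3:
the amalgamated direct sum of the `X^*(L^Π)` (g15-#3 `weilOrbitChar ℤ`) over all `Γ`-orbits `Π ⊂ W_{1,+}(p^∞)`, along the `l^Π`.  The identification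
of `L` with the fundamental group of `LMot(𝔽)` (Thm 4.3 as a statement about motives, resting on Honda–Tate) is NOT formalised.
[cite: Milne1999, §4 Thm 4.3 p. 61 L14; §1 p. 48 L31–L35; §6 p. 65 L17 («L : LMot(𝔽)»)] -/
abbrev LChar : Type := DAmalg ℤ (lFamL (p := p))

variable (p) in
/-- **`l ∈ X^*(L)`**, the common class of the `l^Π`. [cite: Milne1999, §4 Thm 4.3 p. 61; §1 p. 48 L31–L35] -/
def lL : LChar p := dinj ℤ lFamL (Classical.arbitrary (WeilOnePlusOrbits p)) (lFamL (Classical.arbitrary (WeilOnePlusOrbits p)))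

/-- Every `[δ_Π l^Π]` is `l`. [cite: Milne1999, §1 p. 48 L31–L35] -/
theorem dinj_lWeil (c : WeilOnePlusOrbits p) : dinj ℤ lFamL c (lWeil ℤ (lBase c)) = lL p :=
  PairProduct.dinj_t_eq ℤ lFamL c _

/-- Every `[δ_Π (π + ιπ)]`, `π ∈ Π`, is `l`. [cite: Milne1999, §4 p. 60 L25–L26 («independent of the choice of π ∈ Π»)] -/
theorem dinj_tChar_weil (c : WeilOnePlusOrbits p) (π : MulAction.orbit (cmNumbers ≃ₐ[ℚ] cmNumbers) (lBase c)) :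
    dinj ℤ lFamL c (OrbitTorus.tChar ℤ cmNumbersConj π) = lL p := by
  rw [← lWeil_eq_tChar, dinj_lWeil]

variable (p) in
/-- **`β = X^*(β) : X^*(L) → X^*(P) = W(p^∞)`**, the map on characters of `β = (β^Π)_Π : (P, p) → ∏_Π (L^Π, l^Π) = (L, l)`: on the summand `X^*(L^Π)`
it is g15-#3's `X^*(β^Π) = betaChar`, `[f] ↦ ∏_{π∈Π} π^{f(π)}` — well defined on the amalgamated sum because every `l^Π ↦ [p]`.
[cite: Milne1999, §4 p. 62 L17–L23 («the family (β^Π) defines a homomorphism β^K : (P^K, p^K) → (L^K, l^K) … on passing to the inverse limit … β : (P, p) → (L, l)»)] -/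
def betaL : LChar p →ₗ[ℤ] Additive (WeilLimit p) :=
  dliftOf ℤ lFamL (fun c => betaChar (lBase c) (weilLimExp_lBase c)) fun c c' => by
    rw [lFamL_apply, lFamL_apply, betaChar_lWeil, betaChar_lWeil]

/-- `β` on the summand `X^*(L^Π)` is `X^*(β^Π)`. [cite: Milne1999, §4 p. 62 L17–L21] -/
@[simp] theorem betaL_dinj (c : WeilOnePlusOrbits p) (y : weilOrbitChar ℤ (lBase c)) :
    betaL p (dinj ℤ lFamL c y) = betaChar (lBase c) (weilLimExp_lBase c) y :=
  PairProduct.dliftOf_dinj ℤ lFamL _ _ c y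

/-- **`β[δ_π] = [π]`.** [cite: Milne1999, §4 p. 62 L17–L18] -/
theorem betaL_dinj_mk_single (c : WeilOnePlusOrbits p) (π : MulAction.orbit (cmNumbers ≃ₐ[ℚ] cmNumbers) (lBase c)) :
    betaL p (dinj ℤ lFamL c (Submodule.Quotient.mk (Finsupp.single π 1))) = Additive.ofMul (π : WeilLimit p) := by
  rw [betaL_dinj, betaChar_mk_single]

/-- **`β : (L, l) ← (P, p)` is a map of pairs: `X^*(β)(l) = [p]`.** [cite: Milne1999, §4 p. 62 L19–L23 («This map sends p^K to l^Π»)] -/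
theorem betaL_lL : betaL p (lL p) = Additive.ofMul pGerm := by
  rw [lL, betaL_dinj, lFamL_apply, betaChar_lWeil]

end LSide

/-! ### §3 `Ψ ↦ Π(Ψ)` IN THE LIMIT: `π(ψ) = α(𝟙_ψ) ∈ W_{1,+}(p^∞)` at the fixed prime `𝔴` of `ℚ^{cm}` over `p`, and `α′ : X^*(T) → X^*(L)` -/

section Reduction

variable (p : ℕ) [hp : Fact p.Prime] (𝔴 : Ideal (𝓞 cmNumbers)) [h𝔴P : 𝔴.IsPrime] [h𝔴 : 𝔴.LiesOver (Ideal.span {(p : ℤ)})]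

/-- **`π(ψ) := α(𝟙_ψ) ∈ W(p^∞)`, the Weil germ of a CM-type `ψ` on `ℚ^{cm}`** at §6's fixed prime `w₀ = 𝔴` of `ℚ^{al}` over `p` (g20-#3's
limit map `alphaLim p 𝔴` at the character `𝟙_ψ ∈ X^*(S)`; on a finite Galois CM level `K` carrying `ψ` it is g16-#6's `π(Φ) = cmTypeGerm` of the
restricted type, `cmTypeGermLim_extendCMType`). [cite: Milne1999, §5 p. 63 L6–L9 («We sometimes denote this map as g ↦ π(g)»), p. 64 L62 – p. 65 L2, §6 p. 65 («w₀ is a fixed prime of ℚ^{al} lying over p»)] -/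
def cmTypeGermLim (Ψ : GalCMType) : WeilLimit p := Additive.toMul (alphaLim p 𝔴 (indicatorI Ψ))

/-- [cite: Milne1999, §5 p. 63 L6–L9] -/
theorem ofMul_cmTypeGermLim (Ψ : GalCMType) : Additive.ofMul (cmTypeGermLim p 𝔴 Ψ) = alphaLim p 𝔴 (indicatorI Ψ) := rfl

/-- **`π` is `Γ`-equivariant: `π(σψ) = σ·π(ψ)`** («Since the map is Γ-equivariant, to each Γ-orbit Ψ of CM-types it attaches a Γ-orbit Π(Ψ) of Weil
integers»; g20-#3 `alphaLim_rep` + g15-#1 `indicatorI_smul`). [cite: Milne1999, §5 p. 64 L62 – p. 65 L2] -/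
theorem cmTypeGermLim_smul (σ : cmNumbers ≃ₐ[ℚ] cmNumbers) (Ψ : GalCMType) :
    cmTypeGermLim p 𝔴 (σ • Ψ) = σ • cmTypeGermLim p 𝔴 Ψ := by
  apply Additive.ofMul.injective
  rw [ofMul_cmTypeGermLim, indicatorI_smul, alphaLim_rep, weilLimRep_apply]
  rfl

/-- `π` maps the orbit of `Ψ₀` into the orbit of `π(Ψ₀)`. [cite: Milne1999, §5 p. 64 L62 – p. 65 L2] -/
theorem cmTypeGermLim_mem_orbit {Ψ₀ ψ : GalCMType} (h : ψ ∈ MulAction.orbit (cmNumbers ≃ₐ[ℚ] cmNumbers) Ψ₀) :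
    cmTypeGermLim p 𝔴 ψ ∈ MulAction.orbit (cmNumbers ≃ₐ[ℚ] cmNumbers) (cmTypeGermLim p 𝔴 Ψ₀) := by
  obtain ⟨σ, rfl⟩ := h
  exact ⟨σ, (cmTypeGermLim_smul p 𝔴 σ Ψ₀).symm⟩

/-- **`π(ψ) ∈ W_{1,+}(p^∞)`: the germ of a CM-type is a Weil INTEGER of weight `−1`** («sends CM-types on K to Weil integers of weight −1»): computed
on a finite Galois CM level `K` carrying `𝟙_ψ` (g20-#3 `alphaLim_apply_of_mem`), where it is g16-#4's `toMul_alphaCharOfPrime_mem_weilLimOnePlus` for the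
non-negative character `𝟙_ψ|_K` with `𝟙_ψ(1) + 𝟙_ψ(ι) = 1`. [cite: Milne1999, §5 p. 64 L62–L63, §4 p. 60 L11–L12] -/
theorem cmTypeGermLim_mem_weilLimOnePlus (Ψ : GalCMType) : cmTypeGermLim p 𝔴 Ψ ∈ weilLimOnePlus p := by
  have hF := mem_lambdaLevel_cmLevel (indicatorI Ψ)
  change Additive.toMul (alphaLim p 𝔴 (indicatorI Ψ)) ∈ _
  rw [alphaLim_apply_of_mem p 𝔴 (cmLevel (indicatorI Ψ)) (indicatorI Ψ) hF]
  refine toMul_alphaCharOfPrime_mem_weilLimOnePlus p _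
    (resLevel ((cmLevel (indicatorI Ψ) : FiniteGaloisIntermediateField ℚ cmNumbers) : IntermediateField ℚ cmNumbers) 1) _
    (fun τ => ?_) ?_
  · obtain ⟨σ, rfl⟩ := resLevel_surjective _ τ
    rw [levelChar_apply_resLevel, coe_indicatorI]
    exact Set.indicator_nonneg (fun _ _ => zero_le_one) σ
  · rw [← resLevel_mul, mul_one, levelChar_apply_resLevel, levelChar_apply_resLevel]
    by_cases h1 : (1 : cmNumbers ≃ₐ[ℚ] cmNumbers) ∈ Ψ.1
    · have hι : cmNumbersConj ∉ Ψ.1 := by simpa only [mul_one] using (Ψ.2.mem_iff 1).mp h1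
      rw [indicatorI_apply_of_mem h1, indicatorI_apply_of_not_mem hι, add_zero]
    · have hι : cmNumbersConj ∈ Ψ.1 := by
        by_contra hι
        exact h1 ((Ψ.2.mem_iff 1).mpr (by simpa only [mul_one] using hι))
      rw [indicatorI_apply_of_not_mem h1, indicatorI_apply_of_mem hι, zero_add]

/-- Hence `π(ψ)` has weight `−1` (`weilLimExp = 1`). [cite: Milne1999, §5 p. 64 L62–L63] -/
theorem weilLimExp_cmTypeGermLim (Ψ : GalCMType) : weilLimExp (cmTypeGermLim p 𝔴 Ψ) = 1 :=
  weilLimExp_eq_one_of_mem (cmTypeGermLim_mem_weilLimOnePlus p 𝔴 Ψ)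

/-- **`Ψ ↦ Π(Ψ)` on orbit classes**: the class in `Γ\W_{1,+}(p^∞)` of the germ of (the base point of) `Ψ` («to each Γ-orbit Ψ of CM-types it attaches
a Γ-orbit Π(Ψ) of Weil integers of weight −1»). [cite: Milne1999, §5 p. 64 L62 – p. 65 L2] -/
def redIdx (ω : CMTypeOrbits) : WeilOnePlusOrbits p :=
  lClass p (cmTypeGermLim p 𝔴 (orbitBase ω)) (cmTypeGermLim_mem_weilLimOnePlus p 𝔴 _)

/-- `Γ·ϖ_{Π(Ψ)} = Γ·π(Ψ₀)` for the base points. [cite: Milne1999, §5 p. 64 L62 – p. 65 L2] -/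
theorem orbit_lBase_redIdx (ω : CMTypeOrbits) :
    MulAction.orbit (cmNumbers ≃ₐ[ℚ] cmNumbers) (lBase (redIdx p 𝔴 ω)) =
      MulAction.orbit (cmNumbers ≃ₐ[ℚ] cmNumbers) (cmTypeGermLim p 𝔴 (orbitBase ω)) :=
  orbit_lBase_lClass _ _

/-- The class of `π(ψ)` is `Π(Ψ)` for every `ψ ∈ Ψ`. [cite: Milne1999, §5 p. 64 L62 – p. 65 L2] -/
theorem lClass_cmTypeGermLim (ω : CMTypeOrbits) (ψ : MulAction.orbit (cmNumbers ≃ₐ[ℚ] cmNumbers) (orbitBase ω)) :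
    lClass p (cmTypeGermLim p 𝔴 ψ) (cmTypeGermLim_mem_weilLimOnePlus p 𝔴 _) = redIdx p 𝔴 ω :=
  (lClass_eq_lClass_iff _ _ _ _).mpr (cmTypeGermLim_mem_orbit p 𝔴 ψ.2)

/-- **The map of `Γ`-sets `Ψ → Π(Ψ)`, `ψ ↦ π(ψ)`, IN THE LIMIT.** [cite: Milne1999, §5 p. 65 L1–L2 («a surjective Γ-equivariant homomorphism Ψ → Π(Ψ)»)] -/
def redLim (ω : CMTypeOrbits) :
    MulAction.orbit (cmNumbers ≃ₐ[ℚ] cmNumbers) (orbitBase ω) → MulAction.orbit (cmNumbers ≃ₐ[ℚ] cmNumbers) (lBase (redIdx p 𝔴 ω)) :=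
  fun ψ => ⟨cmTypeGermLim p 𝔴 ψ, by
    rw [orbit_lBase_redIdx]
    exact cmTypeGermLim_mem_orbit p 𝔴 ψ.2⟩

/-- [cite: Milne1999, §5 p. 65 L1–L2] -/
@[simp] theorem coe_redLim (ω : CMTypeOrbits) (ψ : MulAction.orbit (cmNumbers ≃ₐ[ℚ] cmNumbers) (orbitBase ω)) :
    ((redLim p 𝔴 ω ψ : MulAction.orbit (cmNumbers ≃ₐ[ℚ] cmNumbers) (lBase (redIdx p 𝔴 ω))) : WeilLimit p) = cmTypeGermLim p 𝔴 ψ := rfl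

/-- **`Ψ → Π(Ψ)` is `Γ`-equivariant.** [cite: Milne1999, §5 p. 65 L1–L2 («Γ-equivariant»)] -/
theorem redLim_smul (ω : CMTypeOrbits) (σ : cmNumbers ≃ₐ[ℚ] cmNumbers)
    (ψ : MulAction.orbit (cmNumbers ≃ₐ[ℚ] cmNumbers) (orbitBase ω)) : redLim p 𝔴 ω (σ • ψ) = σ • redLim p 𝔴 ω ψ :=
  Subtype.ext (by rw [coe_redLim, MulAction.orbit.coe_smul, cmTypeGermLim_smul, MulAction.orbit.coe_smul, coe_redLim])

/-- **`Ψ → Π(Ψ)` is surjective.** [cite: Milne1999, §5 p. 65 L1–L2 («a surjective Γ-equivariant homomorphism»)] -/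
theorem redLim_surjective (ω : CMTypeOrbits) : Function.Surjective (redLim p 𝔴 ω) := fun y => by
  obtain ⟨σ, hσ⟩ : (y : WeilLimit p) ∈ MulAction.orbit (cmNumbers ≃ₐ[ℚ] cmNumbers) (cmTypeGermLim p 𝔴 (orbitBase ω)) := by
    rw [← orbit_lBase_redIdx]
    exact y.2
  refine ⟨σ • ⟨orbitBase ω, MulAction.mem_orbit_self _⟩, Subtype.ext ?_⟩
  rw [coe_redLim, MulAction.orbit.coe_smul, cmTypeGermLim_smul]
  exact hσ

/-- **`X^*(T^Ψ) → X^*(L^{Π(Ψ)})`, `Σ f(ψ)ψ ↦ Σ f(ψ)π(ψ)`, IN THE LIMIT** (g16-#6's generic push-forward `OrbitTorus.push` along `Ψ → Π(Ψ)`): the summand of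
`α′ = X^*(α′)` at `Ψ`. [cite: Milne1999, §5 p. 65 L2–L5] -/
def alphaPrimeOrbit (ω : CMTypeOrbits) : torusChar ℤ (orbitBase ω) →ₗ[ℤ] weilOrbitChar ℤ (lBase (redIdx p 𝔴 ω)) :=
  OrbitTorus.push ℤ cmNumbersConj (redLim p 𝔴 ω) fun ψ => redLim_smul p 𝔴 ω cmNumbersConj ψ

/-- `[δ_ψ] ↦ [δ_{π(ψ)}]`. [cite: Milne1999, §5 p. 65 L2–L5] -/
@[simp] theorem alphaPrimeOrbit_mk_single (ω : CMTypeOrbits) (ψ : MulAction.orbit (cmNumbers ≃ₐ[ℚ] cmNumbers) (orbitBase ω)) :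
    alphaPrimeOrbit p 𝔴 ω (Submodule.Quotient.mk (Finsupp.single ψ 1)) = Submodule.Quotient.mk (Finsupp.single (redLim p 𝔴 ω ψ) 1) :=
  OrbitTorus.push_mk_single ℤ cmNumbersConj _ _ ψ

/-- **«sending `t^Ψ` to `l^Π`».** [cite: Milne1999, §5 p. 65 L4–L5] -/
theorem alphaPrimeOrbit_tTorus (ω : CMTypeOrbits) : alphaPrimeOrbit p 𝔴 ω (tTorus ℤ (orbitBase ω)) = lWeil ℤ (lBase (redIdx p 𝔴 ω)) :=
  (OrbitTorus.push_tChar ℤ cmNumbersConj (redLim p 𝔴 ω) (fun ψ => redLim_smul p 𝔴 ω cmNumbersConj ψ) _).trans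
    (lWeil_eq_tChar ℤ _ _).symm

/-- The summand map is `Γ`-equivariant. [cite: Milne1999, §5 p. 65 L1–L5] -/
theorem alphaPrimeOrbit_rep (ω : CMTypeOrbits) (σ : cmNumbers ≃ₐ[ℚ] cmNumbers) (x : torusChar ℤ (orbitBase ω)) :
    alphaPrimeOrbit p 𝔴 ω (torusRep ℤ (orbitBase ω) σ x) = weilOrbitRep ℤ (lBase (redIdx p 𝔴 ω)) σ (alphaPrimeOrbit p 𝔴 ω x) :=
  OrbitTorus.push_rep ℤ cmNumbersConj _ _ cmNumbersConj_mul_comm (redLim_smul p 𝔴 ω) σ x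

/-- **«This last map induces a surjective homomorphism `X^*(T^Ψ) → X^*(L^Π)`»**, in the limit. [cite: Milne1999, §5 p. 65 L2–L4] -/
theorem alphaPrimeOrbit_surjective (ω : CMTypeOrbits) : Function.Surjective (alphaPrimeOrbit p 𝔴 ω) :=
  OrbitTorus.push_surjective ℤ cmNumbersConj _ _ (redLim_surjective p 𝔴 ω)

variable [DecidableEq CMTypeOrbits] [DecidableEq (MulAction.orbitRel.Quotient (cmNumbers ≃ₐ[ℚ] cmNumbers) (WeilLimit p))]

omit [DecidableEq CMTypeOrbits] in
/-- `α′` respects the relations: `δ_{Π(Ψ)} X^*(α′^Ψ)(t^Ψ) − δ_{Π(Ψ′)} X^*(α′^{Ψ′})(t^{Ψ′}) = δ_{Π(Ψ)} l^{Π(Ψ)} − δ_{Π(Ψ′)} l^{Π(Ψ′)}` is a relation of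
`X^*(L)`. [cite: Milne1999, §5 p. 65 L4–L9 («sending t^Ψ to l^Π … On combining these maps for all Ψ»)] -/
theorem lof_alphaPrimeOrbit_tFamT_sub_mem (ω ω' : CMTypeOrbits) :
    (DirectSum.lof ℤ _ (fun c : WeilOnePlusOrbits p => weilOrbitChar ℤ (lBase c)) (redIdx p 𝔴 ω) ∘ₗ alphaPrimeOrbit p 𝔴 ω) (tFamT ω) -
        (DirectSum.lof ℤ _ (fun c : WeilOnePlusOrbits p => weilOrbitChar ℤ (lBase c)) (redIdx p 𝔴 ω') ∘ₗ alphaPrimeOrbit p 𝔴 ω') (tFamT ω') ∈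
      PairProduct.drel ℤ (lFamL (p := p)) := by
  have h : ∀ ω₁ : CMTypeOrbits,
      (DirectSum.lof ℤ _ (fun c : WeilOnePlusOrbits p => weilOrbitChar ℤ (lBase c)) (redIdx p 𝔴 ω₁) ∘ₗ alphaPrimeOrbit p 𝔴 ω₁) (tFamT ω₁) =
        DirectSum.lof ℤ _ (fun c : WeilOnePlusOrbits p => weilOrbitChar ℤ (lBase c)) (redIdx p 𝔴 ω₁) (lFamL (redIdx p 𝔴 ω₁)) :=
    fun ω₁ => congrArg (DirectSum.lof ℤ _ (fun c : WeilOnePlusOrbits p => weilOrbitChar ℤ (lBase c)) (redIdx p 𝔴 ω₁)) (alphaPrimeOrbit_tTorus p 𝔴 ω₁)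
  rw [h ω, h ω']
  exact PairProduct.lof_sub_lof_mem ℤ lFamL _ _

/-- **`α′ = X^*(α′) : X^*(T) → X^*(L)`**, the map on characters of `α′ : (L, l) → (T, t)` («On combining these maps for all Ψ»): on the summand
`X^*(T^Ψ)` it is `X^*(T^Ψ) → X^*(L^{Π(Ψ)}) ⊂ X^*(L)`; well defined on the amalgamated sum because `t^Ψ ↦ l^{Π(Ψ)}`.
[cite: Milne1999, §5 p. 65 L2–L9 («we obtain a injective homomorphism α′^K : (L^K, l^K) → (T^K, t^K)»), §6 p. 65 (the diagram, arrow `α′`)] -/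
def alphaPrimeT : TChar →ₗ[ℤ] LChar p :=
  PairProduct.dmapOf ℤ tFamT lFamL
    (fun ω => DirectSum.lof ℤ _ (fun c : WeilOnePlusOrbits p => weilOrbitChar ℤ (lBase c)) (redIdx p 𝔴 ω) ∘ₗ alphaPrimeOrbit p 𝔴 ω)
    (lof_alphaPrimeOrbit_tFamT_sub_mem p 𝔴)

/-- `α′` on the summand `X^*(T^Ψ)`. [cite: Milne1999, §5 p. 65 L2–L9] -/
@[simp] theorem alphaPrimeT_dinj (ω : CMTypeOrbits) (x : torusChar ℤ (orbitBase ω)) :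
    alphaPrimeT p 𝔴 (dinj ℤ tFamT ω x) = dinj ℤ lFamL (redIdx p 𝔴 ω) (alphaPrimeOrbit p 𝔴 ω x) :=
  PairProduct.dmapOf_dinj ℤ tFamT lFamL _ _ ω x

/-- **`α′[δ_ψ] = [δ_{π(ψ)}]`.** [cite: Milne1999, §5 p. 65 L2–L5] -/
theorem alphaPrimeT_dinj_mk_single (ω : CMTypeOrbits) (ψ : MulAction.orbit (cmNumbers ≃ₐ[ℚ] cmNumbers) (orbitBase ω)) :
    alphaPrimeT p 𝔴 (dinj ℤ tFamT ω (Submodule.Quotient.mk (Finsupp.single ψ 1))) =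
      dinj ℤ lFamL (redIdx p 𝔴 ω) (Submodule.Quotient.mk (Finsupp.single (redLim p 𝔴 ω ψ) 1)) := by
  rw [alphaPrimeT_dinj, alphaPrimeOrbit_mk_single]

/-- **`α′ : (L, l) → (T, t)` is a map of pairs: `X^*(α′)(t) = l`.** [cite: Milne1999, §5 p. 65 L4–L9 («sending t^Ψ to l^Π»)] -/
theorem alphaPrimeT_tT : alphaPrimeT p 𝔴 tT = lL p := by
  rw [tT, alphaPrimeT_dinj, tFamT_apply, alphaPrimeOrbit_tTorus, dinj_lWeil]

end Reduction

/-! ### §4 LEMMA 6.2 IN THE LIMIT: the square `X^*(T) → X^*(S)` over `X^*(L) → X^*(P)` commutes — «On passing to the limit over all K ⊂ ℚ^{cm}, we find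
that the diagram referred to in Theorem 6.1 commutes» -/

section Lemma62

variable (p : ℕ) [hp : Fact p.Prime] (𝔴 : Ideal (𝓞 cmNumbers)) [h𝔴P : 𝔴.IsPrime] [h𝔴 : 𝔴.LiesOver (Ideal.span {(p : ℤ)})]
variable [DecidableEq CMTypeOrbits] [DecidableEq (MulAction.orbitRel.Quotient (cmNumbers ≃ₐ[ℚ] cmNumbers) (WeilLimit p))]

/-- On a generator `[δ_Ψ δ_ψ]` of `X^*(T)` both paths give `π(ψ)` («its image in `X^*(P^K)` under either map in the diagram is `∏_{ψ∈Ψ} π(ψ)^{f(ψ)}`»).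
[cite: Milne1999, §6 p. 66 L9–L12 (proof of Lemma 6.2)] -/
theorem betaL_alphaPrimeT_dinj_mk_single (ω : CMTypeOrbits) (ψ : MulAction.orbit (cmNumbers ≃ₐ[ℚ] cmNumbers) (orbitBase ω)) :
    betaL p (alphaPrimeT p 𝔴 (dinj ℤ tFamT ω (Submodule.Quotient.mk (Finsupp.single ψ 1)))) =
      alphaLim p 𝔴 (gammaT (dinj ℤ tFamT ω (Submodule.Quotient.mk (Finsupp.single ψ 1)))) := by
  rw [alphaPrimeT_dinj_mk_single, betaL_dinj_mk_single, coe_redLim, gammaT_dinj_mk_single]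
  rfl

/-- **MILNE 1999 LEMMA 6.2 IN THE LIMIT, ON CHARACTERS: the square of character groups `X^*(T) −X^*(γ)→ X^*(S)` over
`X^*(L) −X^*(β)→ X^*(P)`, with verticals `X^*(α′)` and `X^*(α)`, COMMUTES — `X^*(β) ∘ X^*(α′) = X^*(α) ∘ X^*(γ)`** (the maps on characters of
`T ← S`, `T ← L ← P`, `S ← P` at §6's fixed prime `w₀` of `ℚ^{al}` over `p`, over ALL `Γ`-orbits of CM-types on `ℚ^{cm}` and ALL `Γ`-orbits in
`W_{1,+}(p^∞)` at once).  Printed: «LEMMA 6.2. The diagram [`T^K ← S^K` over `L^K ← P^K`] commutes. Proof. We check this on the character groups. Let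
`Ψ` be a `Γ`-orbit of CM-types on `K`, and let `f ∈ ℤ^Ψ`. Then `f` represents an element of `X^*(T^K)`, and its image in `X^*(P^K) = W^K(p^∞)` under
either map in the diagram is `∏_{ψ∈Ψ} π(ψ)^{f(ψ)}`. On passing to the limit over all `K ⊂ ℚ^{cm}`, we find that the diagram referred to in Theorem
6.1 commutes.»  The Tannakian meaning of the four groups and THEOREM 6.1 itself (`P = L ∩ S`) are NOT claimed here.
[cite: Milne1999, §6 p. 66 L5–L12 (Lemma 6.2 and «On passing to the limit»), p. 65 (the diagram)] -/
theorem betaL_comp_alphaPrimeT : betaL p ∘ₗ alphaPrimeT p 𝔴 = alphaLim p 𝔴 ∘ₗ gammaT := by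
  refine PairProduct.hom_ext ℤ tFamT fun ω => OrbitTorus.charModule_hom_ext ℤ cmNumbersConj fun ψ => ?_
  change betaL p (alphaPrimeT p 𝔴 (dinj ℤ tFamT ω _)) = alphaLim p 𝔴 (gammaT (dinj ℤ tFamT ω _))
  exact betaL_alphaPrimeT_dinj_mk_single p 𝔴 ω ψ

/-- LEMMA 6.2 in the limit, pointwise: `β(α′(x)) = α(γ(x))` for every `x ∈ X^*(T)`. [cite: Milne1999, §6 p. 66 L5–L12] -/
theorem betaL_alphaPrimeT (x : TChar) : betaL p (alphaPrimeT p 𝔴 x) = alphaLim p 𝔴 (gammaT x) :=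
  LinearMap.congr_fun (betaL_comp_alphaPrimeT p 𝔴) x

omit [DecidableEq CMTypeOrbits] [DecidableEq (MulAction.orbitRel.Quotient (cmNumbers ≃ₐ[ℚ] cmNumbers) (WeilLimit p))] in
/-- **The fourth side is a map of pairs too: `X^*(α)(s) = [p]`** (g20-#3 `alphaLim_const_one`, Remark 5.2 (c) in the limit). With `gammaT_tT`, `alphaPrimeT_tT`,
`betaL_lL`: all four arrows of the square are maps of pairs `(T, t) ← (S, s)`, `(T, t) ← (L, l) ← (P, p)`, `(S, s) ← (P, p)`.
[cite: Milne1999, §5 p. 63 Rem. 5.2 (c) («α^K sends p^K to s^K»), §6 p. 65 (the diagram)] -/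
theorem alphaLim_sChar : alphaLim p 𝔴 sChar = Additive.ofMul (pGerm : WeilLimit p) :=
  alphaLim_const_one p 𝔴

/-- The two composites agree on the distinguished characters: `β(α′(t)) = α(γ(t)) = [p]`. [cite: Milne1999, §6 p. 66 L5–L12] -/
theorem betaL_alphaPrimeT_tT : betaL p (alphaPrimeT p 𝔴 tT) = Additive.ofMul (pGerm : WeilLimit p) := by
  rw [alphaPrimeT_tT, betaL_lL]

end Lemma62

/-! ### §5 Every `Π ∈ Γ\W_{1,+}(p^∞)` is a `Π(Ψ)`; the arrows `α`, `β`, `γ`, `α′` are all surjective on characters (injective on the groups) -/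

section Surjective

variable (p : ℕ) [hp : Fact p.Prime] (𝔴 : Ideal (𝓞 cmNumbers)) [h𝔴P : 𝔴.IsPrime] [h𝔴 : 𝔴.LiesOver (Ideal.span {(p : ℤ)})]

/-- **Finite Galois CM levels INSIDE `ℚ^{cm}` carry every germ**: every `x ∈ W(p^∞)` lies in `W^E(p^∞)` for some finite Galois CM level `E ⊂ ℚ^{cm}`
(read as Mathlib's `FiniteGaloisIntermediateField ℚ cmNumbers` with the inclusion `resLevel E 1`) — g20-#1's `exists_level_mem_weilLimitIn'` (an abstract
Galois CM `K → ℚ^{cm}`) moved inside `ℚ^{cm}` through a primitive element, as in g20-#3's `alphaLim_surjective`.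
[cite: Milne1999, §4 p. 61 L19–L21, p. 62 L28–L31 («On passing to the inverse limit over all K ⊂ ℚ^{cm} finite and Galois over ℚ»)] -/
theorem exists_finiteGaloisLevel_mem_weilLimitIn (x : WeilLimit p) :
    ∃ (E : FiniteGaloisIntermediateField ℚ cmNumbers) (_ : IsCMField (E : IntermediateField ℚ cmNumbers)),
      x ∈ weilLimitIn (E : IntermediateField ℚ cmNumbers) p (resLevel (E : IntermediateField ℚ cmNumbers) 1) := by
  obtain ⟨K, _, _, _, _, τ₀, hx⟩ := exists_level_mem_weilLimitIn' (p := p) x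
  obtain ⟨θ, hθ⟩ := Field.exists_primitive_element ℚ K
  let E : FiniteGaloisIntermediateField ℚ cmNumbers := FiniteGaloisIntermediateField.adjoin ℚ ({τ₀ θ} : Set cmNumbers) ⊔ levelI
  haveI : IsCMField (E : IntermediateField ℚ cmNumbers) :=
    isCMField_of_iCM_mem E ((FiniteGaloisIntermediateField.le_iff _ _).mp (le_sup_right : levelI ≤ E) iCM_mem_levelI)
  have hθE : τ₀ θ ∈ (E : IntermediateField ℚ cmNumbers) :=
    (FiniteGaloisIntermediateField.le_iff _ _).mp (le_sup_left : FiniteGaloisIntermediateField.adjoin ℚ ({τ₀ θ} : Set cmNumbers) ≤ E)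
      (FiniteGaloisIntermediateField.subset_adjoin ℚ _ (Set.mem_singleton (τ₀ θ)))
  have hτ₀ : ∀ y : K, τ₀ y ∈ (E : IntermediateField ℚ cmNumbers) := fun y => by
    have hy : y ∈ ℚ⟮θ⟯ := by rw [hθ]; exact IntermediateField.mem_top
    have hy' : τ₀ y ∈ IntermediateField.map τ₀ ℚ⟮θ⟯ := ⟨y, hy, rfl⟩
    rw [IntermediateField.adjoin_map, Set.image_singleton] at hy'
    exact IntermediateField.adjoin_simple_le_iff.mpr hθE hy'
  let φ : K →ₐ[ℚ] (E : IntermediateField ℚ cmNumbers) :=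
    { toFun := fun y => ⟨τ₀ y, hτ₀ y⟩
      map_one' := Subtype.ext (map_one τ₀)
      map_mul' := fun a b => Subtype.ext (map_mul τ₀ a b)
      map_zero' := Subtype.ext (map_zero τ₀)
      map_add' := fun a b => Subtype.ext (map_add τ₀ a b)
      commutes' := fun q => Subtype.ext (τ₀.commutes q) }
  exact ⟨E, inferInstance, weilLimitIn_le_of_algHom (p := p) φ τ₀ _ hx⟩

/-- **The CM-type on `ℚ^{cm}` extending a CM type `Φ ⊆ Hom(K, ℚ^{cm})` of a finite level `K ⊂ ℚ^{cm}`: `{σ | σ|_K ∈ Φ}`** (locally constant because `K`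
is finite, a CM-type because `(ισ)|_K = ι ∘ σ|_K`; its indicator is `λ_Φ^{ℚ^{cm}}`, `indicatorI_extendCMType`).
[cite: Milne1999, §2 p. 54 L33–L36 («ψ_τ, when regarded as a map Hom(ℚ^{cm}, ℚ^{al}) → ℤ, is a CM-type on ℚ^{cm}»)] [cite: MilneCM2006, Ch. I §1 p. 19 («the CM-types on ℚ^{cm} are the extensions to ℚ^{cm} of a CM-type on some CM-subfield»)] -/
def extendCMType (K : IntermediateField ℚ cmNumbers) [FiniteDimensional ℚ K] {Φ : Set (K →ₐ[ℚ] cmNumbers)}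
    (hΦ : IsCMTypeWith (cmNumbersConj : cmNumbers ≃ₐ[ℚ] cmNumbers) Φ) : GalCMType :=
  ⟨{σ | resLevel K σ ∈ Φ}, NumberFields.IsCMTypeOn.of_isOpen (by
      classical
      have h := (isLocallyConstant_inflate_resLevel (K := K) (Φ.indicator (1 : (K →ₐ[ℚ] cmNumbers) → ℤ))).isOpen_fiber 1
      convert h using 1
      ext σ
      rw [Set.mem_setOf_eq, Set.mem_setOf_eq, inflate_resLevel_apply]
      by_cases hσ : resLevel K σ ∈ Φ
      · simp only [hσ, Set.indicator_of_mem, Pi.one_apply]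
      · simp only [hσ, Set.indicator_of_notMem, not_false_eq_true, zero_ne_one])
    fun σ => by
      change resLevel K σ ∈ Φ ↔ ¬resLevel K (cmNumbersConj * σ) ∈ Φ
      rw [resLevel_mul]
      exact hΦ.mem_iff _⟩

/-- [cite: Milne1999, §2 p. 54 L33–L36] -/
theorem mem_extendCMType_iff (K : IntermediateField ℚ cmNumbers) [FiniteDimensional ℚ K] {Φ : Set (K →ₐ[ℚ] cmNumbers)}
    (hΦ : IsCMTypeWith (cmNumbersConj : cmNumbers ≃ₐ[ℚ] cmNumbers) Φ) (σ : cmNumbers ≃ₐ[ℚ] cmNumbers) :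
    σ ∈ (extendCMType K hΦ).1 ↔ resLevel K σ ∈ Φ := Iff.rfl

/-- **`𝟙_{Φ^{ℚ^{cm}}} = λ_Φ^{ℚ^{cm}}`**: the indicator of the extended type is g20-#3's `extendLevel K` of g16-#6's `cmTypeChar` `λ_Φ`.
[cite: MilneShih1982Taniyama, III §1 (1.3) (p. 231)] [cite: Milne1999, §2 p. 54 L33–L36] -/
theorem indicatorI_extendCMType (K : IntermediateField ℚ cmNumbers) [FiniteDimensional ℚ K] [IsCMField K] {Φ : Set (K →ₐ[ℚ] cmNumbers)}
    (hΦ : IsCMTypeWith (cmNumbersConj : cmNumbers ≃ₐ[ℚ] cmNumbers) Φ) : indicatorI (extendCMType K hΦ) = extendLevel K (cmTypeChar hΦ) := by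
  classical
  refine Subtype.ext (funext fun σ => ?_)
  rw [coe_indicatorI, coe_extendLevel, inflate_resLevel_apply]
  change ({σ | resLevel K σ ∈ Φ} : Set (cmNumbers ≃ₐ[ℚ] cmNumbers)).indicator 1 σ = Φ.indicator 1 (resLevel K σ)
  by_cases hσ : resLevel K σ ∈ Φ
  · rw [Set.indicator_of_mem (show σ ∈ {σ | resLevel K σ ∈ Φ} from hσ), Set.indicator_of_mem hσ, Pi.one_apply, Pi.one_apply]
  · rw [Set.indicator_of_notMem (show σ ∉ {σ | resLevel K σ ∈ Φ} from hσ), Set.indicator_of_notMem hσ]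

/-- **On a finite Galois CM level the limit germ IS g16-#6's `π(Φ)`**: `π(Φ^{ℚ^{cm}}) = cmTypeGerm p (𝔴 ∩ K) Φ` (g20-#3 `alphaLim_extendLevel`).
[cite: Milne1999, §5 p. 63 L6–L9, p. 64 L62 – p. 65 L2, §6 p. 65 («w₀ is a fixed prime of ℚ^{al} lying over p»)] -/
theorem cmTypeGermLim_extendCMType (K : FiniteGaloisIntermediateField ℚ cmNumbers) [IsCMField (K : IntermediateField ℚ cmNumbers)]
    {Φ : Set ((K : IntermediateField ℚ cmNumbers) →ₐ[ℚ] cmNumbers)} (hΦ : IsCMTypeWith (cmNumbersConj : cmNumbers ≃ₐ[ℚ] cmNumbers) Φ) :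
    cmTypeGermLim p 𝔴 (extendCMType (K : IntermediateField ℚ cmNumbers) hΦ) =
      cmTypeGerm p (𝔴.under (𝓞 (K : IntermediateField ℚ cmNumbers))) hΦ := by
  rw [cmTypeGerm_def, ← alphaLim_extendLevel p 𝔴 K (cmTypeChar hΦ), ← indicatorI_extendCMType]
  rfl

/-- **EVERY GERM IN `W_{1,+}(p^∞)` IS A `π(ψ)`** — `ψ ↦ π(ψ) : {CM-types on ℚ^{cm}} → W_{1,+}(p^∞)` is onto, so every `Γ`-orbit `Π ⊂ W_{1,+}(p^∞)` is a
`Π(Ψ)`: a germ lies in some finite Galois CM level `E ⊂ ℚ^{cm}`, where g16-#6's `exists_cmTypeGerm_eq` (the `{0,1}`-valued Lemma 5.1) writes it as `π(Φ)`,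
`= π(Φ^{ℚ^{cm}})`.  (What the assembly «On combining these maps for all Ψ» of p. 65 uses; not printed.) [cite: Milne1999, §5 p. 65 L1–L9, p. 63 Lemma 5.1] -/
theorem exists_cmTypeGermLim_eq {x : WeilLimit p} (hx : x ∈ weilLimOnePlus p) : ∃ Ψ : GalCMType, cmTypeGermLim p 𝔴 Ψ = x := by
  obtain ⟨E, _, hxE⟩ := exists_finiteGaloisLevel_mem_weilLimitIn p x
  obtain ⟨Φ, hΦ, hΦx⟩ := exists_cmTypeGerm_eq p (𝔴.under (𝓞 (E : IntermediateField ℚ cmNumbers)))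
    (resLevel (E : IntermediateField ℚ cmNumbers) 1) (x := x) ⟨hxE, hx⟩
  exact ⟨extendCMType (E : IntermediateField ℚ cmNumbers) hΦ, by rw [cmTypeGermLim_extendCMType, hΦx]⟩

/-- The base point of a class lies in the orbit of any of its members. [cite: Milne1999, §2 p. 55 (Prop. 2.2)] -/
theorem orbitBase_mem_orbit (Ψ₀ : GalCMType) :
    orbitBase (Quotient.mk'' Ψ₀ : CMTypeOrbits) ∈ MulAction.orbit (cmNumbers ≃ₐ[ℚ] cmNumbers) Ψ₀ := by
  rw [orbit_eq_orbit_orbitBase Ψ₀]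
  exact MulAction.mem_orbit_self _

/-- **Every `Π ∈ Γ\W_{1,+}(p^∞)` is a `Π(Ψ)`: `Ψ ↦ Π(Ψ)` is onto on orbit classes.** [cite: Milne1999, §5 p. 65 L1–L9] -/
theorem redIdx_surjective : Function.Surjective (redIdx p 𝔴) := fun c => by
  obtain ⟨Ψ, hΨ⟩ := exists_cmTypeGermLim_eq p 𝔴 (lBase_mem c)
  refine ⟨Quotient.mk'' Ψ, ?_⟩
  rw [redIdx, ← lClass_lBase c, lClass_eq_lClass_iff]
  simp_rw [← hΨ]
  exact cmTypeGermLim_mem_orbit p 𝔴 (orbitBase_mem_orbit Ψ)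

variable [DecidableEq (MulAction.orbitRel.Quotient (cmNumbers ≃ₐ[ℚ] cmNumbers) (WeilLimit p))]

/-- `[x] ∈ range β` for every `x ∈ W_{1,+}(p^∞)` (the generator `[δ_x]` of `X^*(L^{Γx})`). [cite: Milne1999, §4 p. 62 L17–L21] -/
theorem ofMul_mem_range_betaL {x : WeilLimit p} (hx : x ∈ weilLimOnePlus p) : Additive.ofMul x ∈ LinearMap.range (betaL p) :=
  ⟨dinj ℤ lFamL (lClass p x hx) (Submodule.Quotient.mk (Finsupp.single ⟨x, mem_orbit_lBase_lClass x hx⟩ 1)), betaL_dinj_mk_single _ _⟩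

omit h𝔴P h𝔴 in
/-- **`β = X^*(β) : X^*(L) → X^*(P) = W(p^∞)` IS SURJECTIVE** («β : (P, p) → (L, l) … injective because it corresponds to a surjective map on the character
groups», in the limit): `W(p^∞) = ⋃_E W^E(p^∞)` over the finite Galois CM levels and each `W^E(p^∞)` is generated by `W^E_{1,+}(p^∞) ⊆ W_{1,+}(p^∞)`
(g16-#4 `closure_weilLimitInOnePlus_eq`). [cite: Milne1999, §4 p. 62 L20–L23] -/
theorem betaL_surjective : Function.Surjective (betaL p) := fun y => by
  obtain ⟨E, _, hxE⟩ := exists_finiteGaloisLevel_mem_weilLimitIn p (Additive.toMul y)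
  let S : Subgroup (WeilLimit p) := AddSubgroup.toSubgroup (LinearMap.range (betaL p)).toAddSubgroup
  have hS : weilLimOnePlus p ⊆ S := fun x hx => ofMul_mem_range_betaL p hx
  have hle : weilLimitIn (E : IntermediateField ℚ cmNumbers) p (resLevel (E : IntermediateField ℚ cmNumbers) 1) ≤ S := by
    rw [← closure_weilLimitInOnePlus_eq p (resLevel (E : IntermediateField ℚ cmNumbers) 1), Subgroup.closure_le]
    exact fun x hx => hS hx.2
  exact hle hxE

variable [DecidableEq CMTypeOrbits]

/-- **`α′ = X^*(α′) : X^*(T) → X^*(L)` IS SURJECTIVE** («we obtain a injective homomorphism α′ : L → T», in the limit): every summand `X^*(L^Π)` is hit by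
the summand `X^*(T^Ψ)` with `Π = Π(Ψ)` (`redIdx_surjective`, `alphaPrimeOrbit_surjective`). [cite: Milne1999, §5 p. 65 L5–L9] -/
theorem alphaPrimeT_surjective : Function.Surjective (alphaPrimeT p 𝔴) := fun y => by
  induction y using PairProduct.induction_on ℤ lFamL with
  | zero => exact ⟨0, map_zero _⟩
  | dinj c y =>
    obtain ⟨ω, rfl⟩ := redIdx_surjective p 𝔴 c
    obtain ⟨x, rfl⟩ := alphaPrimeOrbit_surjective p 𝔴 ω y
    exact ⟨dinj ℤ tFamT ω x, alphaPrimeT_dinj p 𝔴 ω x⟩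
  | add y₁ y₂ h₁ h₂ =>
    obtain ⟨x₁, rfl⟩ := h₁
    obtain ⟨x₂, rfl⟩ := h₂
    exact ⟨x₁ + x₂, map_add _ _ _⟩

/-- For the record, the other two arrows: **`γ` and `α` are surjective on characters** (`gammaT_surjective`; g20-#3 `alphaLim_surjective`), so that all four
maps of the limit square are onto — the standing hypothesis «all the maps are surjective» of the almost-cartesian squares of §6 p. 66.
[cite: Milne1999, §6 p. 66 («ALMOST CARTESIAN SQUARES … all the maps are surjective»), §3 Rem. 3.6, §5 Rem. 5.2 (a)] -/
theorem surjective_gammaT_alphaLim_betaL_alphaPrimeT :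
    Function.Surjective gammaT ∧ Function.Surjective (alphaLim p 𝔴) ∧ Function.Surjective (betaL p) ∧
      Function.Surjective (alphaPrimeT p 𝔴) :=
  ⟨gammaT_surjective, alphaLim_surjective p 𝔴, betaL_surjective p, alphaPrimeT_surjective p 𝔴⟩

end Surjective

/-! ### §6 The `Γ`-module structures of `X^*(T)`, `X^*(L)` (summandwise) — the four arrows are `Γ`-equivariant, i.e. homomorphisms of groups over `ℚ` -/

section GaloisAction

variable [DecidableEq CMTypeOrbits]

/-- The summandwise action of `σ ∈ Γ` on `⊕_Ψ X^*(T^Ψ)` respects the relations of the product of pairs (each `t^Ψ` is `Γ`-fixed, Q731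
`torusRep_tTorus`). [cite: Milne1999, §2 p. 55 L45–L47 («fixed by Γ»), §1 p. 48 L31–L35] -/
theorem lof_torusRep_tFamT_sub_mem (σ : cmNumbers ≃ₐ[ℚ] cmNumbers) (ω ω' : CMTypeOrbits) :
    (DirectSum.lof ℤ _ (fun ω : CMTypeOrbits => torusChar ℤ (orbitBase ω)) ω ∘ₗ torusRep ℤ (orbitBase ω) σ) (tFamT ω) -
        (DirectSum.lof ℤ _ (fun ω : CMTypeOrbits => torusChar ℤ (orbitBase ω)) ω' ∘ₗ torusRep ℤ (orbitBase ω') σ) (tFamT ω') ∈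
      PairProduct.drel ℤ tFamT := by
  have h : ∀ ω₁ : CMTypeOrbits,
      (DirectSum.lof ℤ _ (fun ω : CMTypeOrbits => torusChar ℤ (orbitBase ω)) ω₁ ∘ₗ torusRep ℤ (orbitBase ω₁) σ) (tFamT ω₁) =
        DirectSum.lof ℤ _ (fun ω : CMTypeOrbits => torusChar ℤ (orbitBase ω)) ω₁ (tFamT ω₁) :=
    fun ω₁ => congrArg (DirectSum.lof ℤ _ (fun ω : CMTypeOrbits => torusChar ℤ (orbitBase ω)) ω₁) (torusRep_tTorus ℤ (orbitBase ω₁) σ)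
  rw [h ω, h ω']
  exact PairProduct.lof_sub_lof_mem ℤ tFamT ω ω'

/-- The action of `σ ∈ Γ` on `X^*(T)` (summandwise Q731 `torusRep`). [cite: Milne1999, §2 Thm 2.6 p. 56 («T^Ψ … torus over ℚ»), §1 p. 48 L31–L35] -/
def tActT (σ : cmNumbers ≃ₐ[ℚ] cmNumbers) : TChar →ₗ[ℤ] TChar :=
  PairProduct.dmapOf ℤ tFamT tFamT
    (fun ω => DirectSum.lof ℤ _ (fun ω : CMTypeOrbits => torusChar ℤ (orbitBase ω)) ω ∘ₗ torusRep ℤ (orbitBase ω) σ)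
    (lof_torusRep_tFamT_sub_mem σ)

/-- `σ[δ_Ψ x] = [δ_Ψ (σx)]`. [cite: Milne1999, §2 p. 55 L38–L47] -/
@[simp] theorem tActT_dinj (σ : cmNumbers ≃ₐ[ℚ] cmNumbers) (ω : CMTypeOrbits) (x : torusChar ℤ (orbitBase ω)) :
    tActT σ (dinj ℤ tFamT ω x) = dinj ℤ tFamT ω (torusRep ℤ (orbitBase ω) σ x) :=
  PairProduct.dmapOf_dinj ℤ tFamT tFamT _ _ ω x

/-- [cite: Milne1999, §2 p. 55 L38–L47] -/
theorem tActT_one : tActT 1 = LinearMap.id :=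
  PairProduct.hom_ext ℤ tFamT fun ω => LinearMap.ext fun x => by
    change tActT 1 (dinj ℤ tFamT ω x) = dinj ℤ tFamT ω x
    rw [tActT_dinj, map_one, Module.End.one_apply]

/-- [cite: Milne1999, §2 p. 55 L38–L47] -/
theorem tActT_mul (σ τ : cmNumbers ≃ₐ[ℚ] cmNumbers) : tActT (σ * τ) = tActT σ * tActT τ :=
  PairProduct.hom_ext ℤ tFamT fun ω => LinearMap.ext fun x => by
    change tActT (σ * τ) (dinj ℤ tFamT ω x) = tActT σ (tActT τ (dinj ℤ tFamT ω x))
    rw [tActT_dinj, map_mul, Module.End.mul_apply, tActT_dinj, tActT_dinj]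

/-- **`X^*(T)` as a `Γ`-module** (`T = ∏_Ψ (T^Ψ, t^Ψ)` is a group over `ℚ`): the summandwise action. [cite: Milne1999, §2 Thm 2.6 p. 56; §1 p. 48 L31–L35] -/
def tRepT : Representation ℤ (cmNumbers ≃ₐ[ℚ] cmNumbers) TChar where
  toFun := tActT
  map_one' := tActT_one
  map_mul' := tActT_mul

/-- [cite: Milne1999, §2 p. 55 L38–L47] -/
@[simp] theorem tRepT_dinj (σ : cmNumbers ≃ₐ[ℚ] cmNumbers) (ω : CMTypeOrbits) (x : torusChar ℤ (orbitBase ω)) :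
    tRepT σ (dinj ℤ tFamT ω x) = dinj ℤ tFamT ω (torusRep ℤ (orbitBase ω) σ x) :=
  tActT_dinj σ ω x

/-- **`t` is `Γ`-fixed** («a homomorphism `t : T → 𝔾_m` rational over ℚ»). [cite: Milne1999, §2 p. 55 L45–L48] -/
theorem tRepT_tT (σ : cmNumbers ≃ₐ[ℚ] cmNumbers) : tRepT σ tT = tT := by
  rw [tT, tRepT_dinj, tFamT_apply, torusRep_tTorus]

/-- **`γ = X^*(γ)` is `Γ`-equivariant** (summandwise g15-#1 `gammaChar_torusRep`): `γ` is a homomorphism `S → T` of groups over `ℚ`.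
[cite: Milne1999, §3 p. 59 L3–L8 (Prop. 3.5)] -/
theorem gammaT_rep (σ : cmNumbers ≃ₐ[ℚ] cmNumbers) (x : TChar) : gammaT (tRepT σ x) = infinityTypesCMRep σ (gammaT x) :=
  -- term mode on purpose: `rw` across the two `ℤ`-module structures on the quotient carriers is prohibitively slow
  LinearMap.congr_fun (PairProduct.hom_ext ℤ tFamT (f := gammaT ∘ₗ tRepT σ)
    (g := (infinityTypesCMRep σ : infinityTypesCM →ₗ[ℤ] infinityTypesCM) ∘ₗ gammaT) fun ω => LinearMap.ext fun y =>
      (congrArg gammaT (tRepT_dinj σ ω y)).trans (((gammaT_dinj ω _).trans (gammaChar_torusRep _ σ y)).trans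
        (congrArg (infinityTypesCMRep σ) (gammaT_dinj ω y)).symm)) x

variable {p : ℕ} [hp : Fact p.Prime] [DecidableEq (MulAction.orbitRel.Quotient (cmNumbers ≃ₐ[ℚ] cmNumbers) (WeilLimit p))]

omit [DecidableEq CMTypeOrbits] in
/-- The summandwise action on `⊕_Π X^*(L^Π)` respects the relations (each `l^Π` is `Γ`-fixed, g15-#3 `weilOrbitRep_lWeil`).
[cite: Milne1999, §4 p. 60 L26 («fixed by Γ»), §1 p. 48 L31–L35] -/
theorem lof_weilOrbitRep_lFamL_sub_mem (σ : cmNumbers ≃ₐ[ℚ] cmNumbers) (c c' : WeilOnePlusOrbits p) :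
    (DirectSum.lof ℤ _ (fun c : WeilOnePlusOrbits p => weilOrbitChar ℤ (lBase c)) c ∘ₗ weilOrbitRep ℤ (lBase c) σ) (lFamL c) -
        (DirectSum.lof ℤ _ (fun c : WeilOnePlusOrbits p => weilOrbitChar ℤ (lBase c)) c' ∘ₗ weilOrbitRep ℤ (lBase c') σ) (lFamL c') ∈
      PairProduct.drel ℤ (lFamL (p := p)) := by
  have h : ∀ c₁ : WeilOnePlusOrbits p,
      (DirectSum.lof ℤ _ (fun c : WeilOnePlusOrbits p => weilOrbitChar ℤ (lBase c)) c₁ ∘ₗ weilOrbitRep ℤ (lBase c₁) σ) (lFamL c₁) =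
        DirectSum.lof ℤ _ (fun c : WeilOnePlusOrbits p => weilOrbitChar ℤ (lBase c)) c₁ (lFamL c₁) :=
    fun c₁ => congrArg (DirectSum.lof ℤ _ (fun c : WeilOnePlusOrbits p => weilOrbitChar ℤ (lBase c)) c₁) (weilOrbitRep_lWeil ℤ (lBase c₁) σ)
  rw [h c, h c']
  exact PairProduct.lof_sub_lof_mem ℤ lFamL c c'

omit [DecidableEq CMTypeOrbits] in
/-- The action of `σ ∈ Γ` on `X^*(L)` (summandwise g15-#3 `weilOrbitRep`). [cite: Milne1999, §4 p. 60 L22–L27, Thm 4.3 p. 61] -/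
def lActL (σ : cmNumbers ≃ₐ[ℚ] cmNumbers) : LChar p →ₗ[ℤ] LChar p :=
  PairProduct.dmapOf ℤ lFamL lFamL
    (fun c => DirectSum.lof ℤ _ (fun c : WeilOnePlusOrbits p => weilOrbitChar ℤ (lBase c)) c ∘ₗ weilOrbitRep ℤ (lBase c) σ)
    (lof_weilOrbitRep_lFamL_sub_mem σ)

omit [DecidableEq CMTypeOrbits] in
/-- `σ[δ_Π y] = [δ_Π (σy)]`. [cite: Milne1999, §4 p. 60 L22–L27] -/
@[simp] theorem lActL_dinj (σ : cmNumbers ≃ₐ[ℚ] cmNumbers) (c : WeilOnePlusOrbits p) (y : weilOrbitChar ℤ (lBase c)) :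
    lActL σ (dinj ℤ lFamL c y) = dinj ℤ lFamL c (weilOrbitRep ℤ (lBase c) σ y) :=
  PairProduct.dmapOf_dinj ℤ lFamL lFamL _ _ c y

omit [DecidableEq CMTypeOrbits] in
/-- [cite: Milne1999, §4 p. 60 L22–L27] -/
theorem lActL_one : lActL (p := p) 1 = LinearMap.id :=
  PairProduct.hom_ext ℤ lFamL fun c => LinearMap.ext fun y => by
    change lActL 1 (dinj ℤ lFamL c y) = dinj ℤ lFamL c y
    rw [lActL_dinj, map_one, Module.End.one_apply]

omit [DecidableEq CMTypeOrbits] in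
/-- [cite: Milne1999, §4 p. 60 L22–L27] -/
theorem lActL_mul (σ τ : cmNumbers ≃ₐ[ℚ] cmNumbers) : lActL (p := p) (σ * τ) = lActL σ * lActL τ :=
  PairProduct.hom_ext ℤ lFamL fun c => LinearMap.ext fun y => by
    change lActL (σ * τ) (dinj ℤ lFamL c y) = lActL σ (lActL τ (dinj ℤ lFamL c y))
    rw [lActL_dinj, map_mul, Module.End.mul_apply, lActL_dinj, lActL_dinj]

variable (p) in
omit [DecidableEq CMTypeOrbits] in
/-- **`X^*(L)` as a `Γ`-module** (`L = ∏_Π (L^Π, l^Π)` is a group over `ℚ`): the summandwise action. [cite: Milne1999, §4 Thm 4.3 p. 61; §1 p. 48 L31–L35] -/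
def lRepL : Representation ℤ (cmNumbers ≃ₐ[ℚ] cmNumbers) (LChar p) where
  toFun := lActL
  map_one' := lActL_one
  map_mul' := lActL_mul

omit [DecidableEq CMTypeOrbits] in
/-- [cite: Milne1999, §4 p. 60 L22–L27] -/
@[simp] theorem lRepL_dinj (σ : cmNumbers ≃ₐ[ℚ] cmNumbers) (c : WeilOnePlusOrbits p) (y : weilOrbitChar ℤ (lBase c)) :
    lRepL p σ (dinj ℤ lFamL c y) = dinj ℤ lFamL c (weilOrbitRep ℤ (lBase c) σ y) :=
  lActL_dinj σ c y

omit [DecidableEq CMTypeOrbits] in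
/-- **`l` is `Γ`-fixed** («`l^Π : L^Π → 𝔾_m` rational over ℚ»). [cite: Milne1999, §4 p. 60 L26–L27] -/
theorem lRepL_lL (σ : cmNumbers ≃ₐ[ℚ] cmNumbers) : lRepL p σ (lL p) = lL p := by
  rw [lL, lRepL_dinj, lFamL_apply, weilOrbitRep_lWeil]

omit [DecidableEq CMTypeOrbits] in
/-- **`β = X^*(β)` is `Γ`-equivariant** (summandwise g15-#3 `betaChar_weilOrbitRep`): `β : P → L` is a homomorphism of groups over `ℚ`.
[cite: Milne1999, §4 p. 62 L17–L23] -/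
theorem betaL_rep (σ : cmNumbers ≃ₐ[ℚ] cmNumbers) (y : LChar p) : betaL p (lRepL p σ y) = weilLimRep p σ (betaL p y) := by
  induction y using PairProduct.induction_on ℤ lFamL with
  | zero => simp only [map_zero]
  | dinj c z =>
    calc betaL p (lRepL p σ (dinj ℤ lFamL c z))
        = betaL p (dinj ℤ lFamL c (weilOrbitRep ℤ (lBase c) σ z)) := congrArg (betaL p) (lRepL_dinj σ c z)
      _ = betaChar (lBase c) (weilLimExp_lBase c) (weilOrbitRep ℤ (lBase c) σ z) := betaL_dinj c _
      _ = weilLimRep p σ (betaChar (lBase c) (weilLimExp_lBase c) z) := betaChar_weilOrbitRep (lBase c) (weilLimExp_lBase c) σ z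
      _ = weilLimRep p σ (betaL p (dinj ℤ lFamL c z)) := congrArg (weilLimRep p σ) (betaL_dinj c z).symm
  | add x y hx hy => simp only [map_add, hx, hy]

variable (p) (𝔴 : Ideal (𝓞 cmNumbers)) [h𝔴P : 𝔴.IsPrime] [h𝔴 : 𝔴.LiesOver (Ideal.span {(p : ℤ)})]

/-- **`α′ = X^*(α′)` is `Γ`-equivariant** (summandwise `alphaPrimeOrbit_rep`): `α′ : L → T` is a homomorphism of groups over `ℚ`.
[cite: Milne1999, §5 p. 65 L1–L9] -/
theorem alphaPrimeT_rep (σ : cmNumbers ≃ₐ[ℚ] cmNumbers) (x : TChar) : alphaPrimeT p 𝔴 (tRepT σ x) = lRepL p σ (alphaPrimeT p 𝔴 x) :=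
  LinearMap.congr_fun (PairProduct.hom_ext ℤ tFamT (f := alphaPrimeT p 𝔴 ∘ₗ tRepT σ) (g := lRepL p σ ∘ₗ alphaPrimeT p 𝔴)
    fun ω => LinearMap.ext fun y =>
      (congrArg (alphaPrimeT p 𝔴) (tRepT_dinj σ ω y)).trans (((alphaPrimeT_dinj p 𝔴 ω _).trans
        ((congrArg (dinj ℤ lFamL (redIdx p 𝔴 ω)) (alphaPrimeOrbit_rep p 𝔴 ω σ y)).trans (lRepL_dinj σ _ _).symm)).trans
          (congrArg (lRepL p σ) (alphaPrimeT_dinj p 𝔴 ω y)).symm)) x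

end GaloisAction

/-! ### §7 On points: `T(R)`, `L(R)` and the square `T(R) ← S(R) ← P(R)`, `T(R) ← L(R) ← P(R)` for every commutative `ℚ`-algebra `R` -/

section Points

open Literature.RingTheory.GaloisAlgebras.CharacterModuleTorus (torusPoints galUnits)

universe u

variable (p : ℕ) [hp : Fact p.Prime] (𝔴 : Ideal (𝓞 cmNumbers)) [h𝔴P : 𝔴.IsPrime] [h𝔴 : 𝔴.LiesOver (Ideal.span {(p : ℤ)})]
variable [DecidableEq (MulAction.orbitRel.Quotient (cmNumbers ≃ₐ[ℚ] cmNumbers) (WeilLimit p))]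
variable (R : Type u) [CommRing R] [Algebra ℚ R]

/-- **`L(R) = Hom_Γ(X^*(L), (ℚ^{cm} ⊗ R)ˣ)`, the `R`-points of the pro-torus `L = ∏_Π (L^Π, l^Π)`.**
[cite: Milne1999, §4 Thm 4.3 p. 61; §6 p. 65 («L : LMot(𝔽)»)] [cite: Milne2017, Ch. 12 Rem. 12.26] -/
abbrev lTorusPoints : Subgroup (Multiplicative (LChar p) →* (cmNumbers ⊗[ℚ] R)ˣ) := torusPoints ℚ cmNumbers R (lRepL p)

/-- **`l` on points: `L(R) → (ℚ^{cm} ⊗ R)ˣ`, `f ↦ f(l)`.** [cite: Milne1999, §4 Thm 4.3 p. 61 («(L^Π, l^Π)»)] -/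
def lPointsL : lTorusPoints p R →* (cmNumbers ⊗[ℚ] R)ˣ := torusPoints.eval ℚ cmNumbers R (lRepL p) (lL p)

/-- `l` is rational over `ℚ`: its values are `Γ`-invariant units. [cite: Milne1999, §4 p. 60 L26–L27] -/
theorem galUnits_lPointsL (σ : cmNumbers ≃ₐ[ℚ] cmNumbers) (f : lTorusPoints p R) : galUnits ℚ cmNumbers R σ (lPointsL p R f) = lPointsL p R f :=
  torusPoints.galUnits_eval_of_forall_eq ℚ cmNumbers R (lRepL p) (fun τ => lRepL_lL τ) σ f

/-- **`β(R) : P(R) → L(R)` ON POINTS**, `P(R) = weilTorusPoints p R` (g15-#3). [cite: Milne1999, §4 p. 62 L17–L23, §6 p. 65 (the diagram)] -/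
def betaLPoints : weilTorusPoints p R →* lTorusPoints p R :=
  torusPoints.comap ℚ cmNumbers R (lRepL p) (weilLimRep p) (betaL p) (betaL_rep (p := p))

variable {R} in
/-- Values of `β(R)`: `β(f)(y) = f(β y)`. [cite: Milne1999, §4 p. 62 L17–L23] -/
theorem betaLPoints_apply_ofAdd (f : weilTorusPoints p R) (y : LChar p) :
    (betaLPoints p R f : Multiplicative (LChar p) →* (cmNumbers ⊗[ℚ] R)ˣ) (Multiplicative.ofAdd y) =
      (f : Multiplicative (Additive (WeilLimit p)) →* (cmNumbers ⊗[ℚ] R)ˣ) (Multiplicative.ofAdd (betaL p y)) := rfl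

variable {R} in
/-- `β : (P, p) → (L, l)` on points: `l(β(f)) = f([p])` [= g15-#3 `germChar pGerm`]. [cite: Milne1999, §4 p. 62 L19–L23] -/
theorem lPointsL_betaLPoints (f : weilTorusPoints p R) : lPointsL p R (betaLPoints p R f) = germChar pGerm f :=
  (betaLPoints_apply_ofAdd (p := p) f (lL p)).trans (congrArg (fun x : Additive (WeilLimit p) =>
    (f : Multiplicative (Additive (WeilLimit p)) →* (cmNumbers ⊗[ℚ] R)ˣ) (Multiplicative.ofAdd x)) (betaL_lL (p := p)))

variable [DecidableEq CMTypeOrbits]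

omit hp in
/-- **`T(R) = Hom_Γ(X^*(T), (ℚ^{cm} ⊗ R)ˣ)`, the `R`-points of the pro-torus `T = ∏_Ψ (T^Ψ, t^Ψ)`** (Q768's `torusPoints` of the `Γ`-module `X^*(T)`).
[cite: Milne1999, §2 Thm 2.6 p. 56; §6 p. 65 («T : LCM(ℚ^{al})»)] [cite: Milne2017, Ch. 12 Rem. 12.26] -/
abbrev tTorusPoints : Subgroup (Multiplicative TChar →* (cmNumbers ⊗[ℚ] R)ˣ) := torusPoints ℚ cmNumbers R tRepT

omit hp in
/-- **`t` on points: `T(R) → (ℚ^{cm} ⊗ R)ˣ`, `f ↦ f(t)`.** [cite: Milne1999, §2 Thm 2.6 p. 56 («(T^K, t^K)»)] -/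
def tPointsT : tTorusPoints R →* (cmNumbers ⊗[ℚ] R)ˣ := torusPoints.eval ℚ cmNumbers R tRepT tT

omit hp in
/-- `t` is rational over `ℚ`: its values are `Γ`-invariant units. [cite: Milne1999, §2 p. 55 L45–L48] -/
theorem galUnits_tPointsT (σ : cmNumbers ≃ₐ[ℚ] cmNumbers) (f : tTorusPoints R) : galUnits ℚ cmNumbers R σ (tPointsT R f) = tPointsT R f :=
  torusPoints.galUnits_eval_of_forall_eq ℚ cmNumbers R tRepT (fun τ => tRepT_tT τ) σ f

omit hp in
/-- **`γ(R) : S(R) → T(R)` ON POINTS** (Q768 `torusPoints.comap` of the equivariant `X^*(γ)`), `S(R) = serreLimitPoints R` (g13-#4).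
[cite: Milne1999, §3 p. 59 L3–L8 (Prop. 3.5), §6 p. 65 (the diagram)] -/
def gammaTPoints : serreLimitPoints R →* tTorusPoints R :=
  torusPoints.comap ℚ cmNumbers R tRepT infinityTypesCMRep gammaT gammaT_rep

/-- **`α′(R) : L(R) → T(R)` ON POINTS.** [cite: Milne1999, §5 p. 65 L5–L9, §6 p. 65 (the diagram)] -/
def alphaPrimeTPoints : lTorusPoints p R →* tTorusPoints R :=
  torusPoints.comap ℚ cmNumbers R tRepT (lRepL p) (alphaPrimeT p 𝔴) (alphaPrimeT_rep p 𝔴)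

variable {R}

omit hp in
/-- Values of `γ(R)`: `γ(s)(x) = s(γ x)`. [cite: Milne1999, §3 p. 59 L3–L8] -/
theorem gammaTPoints_apply_ofAdd (s : serreLimitPoints R) (x : TChar) :
    (gammaTPoints R s : Multiplicative TChar →* (cmNumbers ⊗[ℚ] R)ˣ) (Multiplicative.ofAdd x) =
      (s : Multiplicative infinityTypesCM →* (cmNumbers ⊗[ℚ] R)ˣ) (Multiplicative.ofAdd (gammaT x)) := rfl

/-- Values of `α′(R)`: `α′(g)(x) = g(α′ x)`. [cite: Milne1999, §5 p. 65 L5–L9] -/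
theorem alphaPrimeTPoints_apply_ofAdd (g : lTorusPoints p R) (x : TChar) :
    (alphaPrimeTPoints p 𝔴 R g : Multiplicative TChar →* (cmNumbers ⊗[ℚ] R)ˣ) (Multiplicative.ofAdd x) =
      (g : Multiplicative (LChar p) →* (cmNumbers ⊗[ℚ] R)ˣ) (Multiplicative.ofAdd (alphaPrimeT p 𝔴 x)) := rfl

omit hp in
/-- `γ : (S, s) → (T, t)` on points: `t(γ(s)) = s(s)` [= g15-#1 `sPoints`]. [cite: Milne1999, §3 p. 59 L5–L8] -/
theorem tPointsT_gammaTPoints (s : serreLimitPoints R) : tPointsT R (gammaTPoints R s) = sPoints R s :=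
  (gammaTPoints_apply_ofAdd s tT).trans (congrArg (fun x : infinityTypesCM =>
    (s : Multiplicative infinityTypesCM →* (cmNumbers ⊗[ℚ] R)ˣ) (Multiplicative.ofAdd x)) gammaT_tT)

/-- `α′ : (L, l) → (T, t)` on points: `t(α′(g)) = l(g)`. [cite: Milne1999, §5 p. 65 L5–L9] -/
theorem tPointsT_alphaPrimeTPoints (g : lTorusPoints p R) : tPointsT R (alphaPrimeTPoints p 𝔴 R g) = lPointsL p R g :=
  (alphaPrimeTPoints_apply_ofAdd p 𝔴 g tT).trans (congrArg (fun x : LChar p =>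
    (g : Multiplicative (LChar p) →* (cmNumbers ⊗[ℚ] R)ˣ) (Multiplicative.ofAdd x)) (alphaPrimeT_tT p 𝔴))

/-- **LEMMA 6.2 IN THE LIMIT ON `R`-POINTS: `γ(R) ∘ α(R) = α′(R) ∘ β(R) : P(R) → T(R)`** for every commutative `ℚ`-algebra `R` — the square
`T ← S ← P`, `T ← L ← P` of the diagram of p. 65 commutes on points (`α(R)` is g20-#3's `alphaLimPoints p 𝔴 R`).
[cite: Milne1999, §6 p. 66 L5–L12 (Lemma 6.2, «On passing to the limit … the diagram referred to in Theorem 6.1 commutes»), p. 65 (the diagram)] -/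
theorem gammaTPoints_alphaLimPoints (f : weilTorusPoints p R) :
    gammaTPoints R (alphaLimPoints p 𝔴 R f) = alphaPrimeTPoints p 𝔴 R (betaLPoints p R f) :=
  -- term mode on purpose: both sides, evaluated at `x`, are the value of `f` at `α(γ x) = β(α′ x)`
  Subtype.ext (MonoidHom.ext fun x =>
    ((gammaTPoints_apply_ofAdd (alphaLimPoints p 𝔴 R f) x.toAdd).trans
      (alphaLimPoints_apply_ofAdd (p := p) (𝔴 := 𝔴) (R := R) f (gammaT x.toAdd))).trans
      ((congrArg (fun y : Additive (WeilLimit p) =>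
          (f : Multiplicative (Additive (WeilLimit p)) →* (cmNumbers ⊗[ℚ] R)ˣ) (Multiplicative.ofAdd y)) (betaL_alphaPrimeT p 𝔴 x.toAdd)).symm.trans
        ((betaLPoints_apply_ofAdd (p := p) f (alphaPrimeT p 𝔴 x.toAdd)).symm.trans
          (alphaPrimeTPoints_apply_ofAdd p 𝔴 (betaLPoints p R f) x.toAdd).symm)))

/-- The same as an identity of homomorphisms `P(R) → T(R)`. [cite: Milne1999, §6 p. 66 L5–L12] -/
theorem gammaTPoints_comp_alphaLimPoints :
    (gammaTPoints R).comp (alphaLimPoints p 𝔴 R) = (alphaPrimeTPoints p 𝔴 R).comp (betaLPoints p R) :=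
  MonoidHom.ext fun f => gammaTPoints_alphaLimPoints p 𝔴 f

end Points

end CMNumbers

end Literature.NumberTheory.ComplexMultiplication

end
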